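import Summits.KontsevichZagierPeriods.KontsevichZagierPeriods.Theses.Grothendieck
import Literature.NumberTheory.Transcendental.KZProductIdeal
import Literature.NumberTheory.Transcendental.KZSubcalculusInvariants
import Literature.NumberTheory.Transcendental.KZIntervalPeriodProofs
import Literature.NumberTheory.Transcendental.KZCalculusProofs
import Literature.Analysis.SpecialFunctions.LemniscaticEllipticValuesProofs
import Literature.Probability.RandomPlanarGeometry.RectangleModulusElliptic
import Literature.Probability.RandomPlanarGeometry.EllipticKBasic
import Literature.NumberTheory.Transcendental.KontsevichZagierGammaProofs
import Literature.ModelTheory.ExponentialFields.OMinimalEulerFibres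
import Literature.ModelTheory.ExponentialFields.RealExpFieldProofs
import Literature.ModelTheory.ExponentialFields.RealClosedFieldTheoryProofs

/-!
# Disproof of `GpcLegendreLemniscatic` (stmt-KontsevichZagierPeriods-0280) — standing adversary, gen 1

Crux (route Grothendieck, rank 5; shared with ZeroPortrait r4, VeryGoodTransfer `LegendreCompiled`
r3, UnfoldedStokes `LegendreLemniscatic`): for every `r : IntegralRep 2` with domain `(0,1)²` and
integrand `2e(x₀)k(x₁) − k(x₀)k(x₁)` (`k(t) = 1/√((1−t²)(1−t²/2))`, `e(t) = √(1−t²/2)/√(1−t²)`,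
Lawden's `K(1/√2)`, `E(1/√2)` densities) and every `r' : IntegralRep 1` with domain `ℝ` and
integrand `1/(2(1+x²))`, `KZ.Equivalent r r'` — Legendre's relation `2EK − K² = π/2` at the
lemniscatic modulus, INSIDE the four-move calculus.

**Verdict of cycle 1: the crux RESISTS; no kill is possible short of disproving the summit.**
All theorems below are sorry-free, axioms ⊆ {propext, Classical.choice, Quot.sound}.

Findings (section numbers refer to the file):

1. §1 VOCABULARY / NON-VACUITY / READBACK. Canonical representations `legendreRep = [g]·[k]`
   (`g = 2e − k = √(1−t²)/√(1−t²/2)`, built with the tree's `IntegralRep.prod`) and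
   `arctanRep = [ℝ, 1/(2(1+x²))]` are constructed (semialgebraicity via the tree's Tarski–Seidenberg
   closure lemmas, integrability via `intervalIntegrable_ellIntegrand`); the crux's printed
   integrand, read with left-associated divisions, EQUALS `g(x₀)k(x₁)` on `(0,1)²`
   (`cruxIntegrand_eq`). VALUES: `legendreRep.value = π/2` (Fubini `value_prod` + tree theorem
   `Lawden1989_eq_3_8_29_lemniscatic_holds`) and `arctanRep.value = π/2` — NO EVALUATION KILL.
   `gpcLegendre_iff : crux ↔ Equivalent legendreRep arctanRep` (identity change of variables
   `equivalent_of_eqOn`): the `∀ r r'` shape and off-domain values are harmless, hypotheses are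
   satisfiable.
2. §2 LOAD-BEARING HYPOTHESES. Each of the four pinning hypotheses (`r.domain`, `r.integrand`,
   `r'.domain`, `r'.integrand`) is necessary: `gpcLegendre_false_without_domainL / _integrandL /
   _domainR / _integrandR` (witnesses `[∅,0]`, `[(0,1)²,0]`, `[∅,0]`, `[ℝ,0]`, separated by `eval`).
3. §3 NECESSARY MOVES. `legendre_not_mem_closure_without_newtonLeibniz`: `[r₀] − [r₀']` is NOT in
   the subgroup generated by rules (1a), (1b), (2) — a Newton–Leibniz move is necessary (invariant
   `eval ∘ dimProj 2`, new tool `dimProj`); this holds for every admissible `r` against EVERY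
   `r' : IntegralRep 1` (`not_mem_closure_without_newtonLeibniz`, hypotheses on `r'` unnecessary).
   Informal (docstring of §3): additivity is necessary too, by the o-minimal Euler characteristic
   of the domain (`χ((0,1)²) = 1 ≠ −1 = χ(ℝ)`, invariant under rules (2), (3)); `KZ.coeffSum` does
   not see it.
4. §4 REFUTED STRENGTHENINGS. (4.1) NO TERMWISE TRANSFER: `not_equivalent_kk_ratArctan`,
   `not_equivalent_ek_ratArctan` — neither `[k]·[k]` (value `K²`) nor `[e]·[k]` (value `EK`) is
   equivalent to any `[ℝ, q/(1+x²)]`, `q ∈ ℚ` (Chudnovsky `algebraicIndependent_real_pi_gamma_one_quarter`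
   + Lawden (4.3.6), both tree theorems: `Γ(¼)⁴ ≠ c·π²`); a derivation must mix the `E`- and
   `K`-parts before descending. (4.2) THE CM POINT IS LOAD-BEARING: the same shape at parameter
   `m` (`LegendreShape m`; `legendreShape_half_iff : LegendreShape ½ ↔ crux`) is FALSE at `m = 0`
   (`not_legendreShape_zero`, value `(π/2)² ≠ π/2`); by value false on `[0,1) ∖ {½}` (strict
   antitonicity, route ZeroPortrait 12735/11726) and vacuous at `m = 1`.
5. §5 WHY IT RESISTS — THE KILL CRITERION, FORMAL: `gpcLegendre_of_kontsevichZagierPeriods :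
   KontsevichZagierPeriods → GpcLegendreLemniscatic` (tree theorem
   `KZ.exists_isRational_equivalent_holds` + soundness + the value identity). A refutation of the
   crux would refute Conjecture 1 as typed (`not_kontsevichZagierPeriods_of_not_gpcLegendre`); the
   only conceivable weapon is a new additive invariant of the full calculus separating equal-valued
   representations. None is known; the dimension-graded and window-restricted evaluations, the
   coefficient sum and `χ` all fail to separate (§3).
6. §6 CHAIN AUDIT (comments at the end): the McKean–Moll/Dirichlet chain of grounder g15-12
   (evidence `LegendreLemniscatic_KZchain.md`) re-derived symbolically here: every intermediate
   integrand is a product of rational powers with exponents `> −1` at each boundary stratum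
   (absolutely convergent), every change of variables is polynomial/algebraic, injective and `C¹`
   on the open cell, and the two primitives (`x√(1−x²)/√(1+x²)·(1−y⁴)^{-1/2}` and
   `4s^{1/4}τ^{-1/2}(1−τ)^{-1/2}`) are semialgebraic and continuous on the closed fibre. The direct
   descent `∫ k(x₁) dx₁` is impossible (no semialgebraic primitive of `k` or `e`: the differential
   `dt/√((1−t²)(1−t²/2))` of the first kind is not exact on the elliptic curve — cf. barrier
   `Literature.Barriers.KontsevichZagierPeriods` `AlgebraicPrimitivesObstruction`, Cresson–Viu-Sos
   2022 §2.1), which is why the chain first cancels the non-Beta part by the exact term `F′`.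
7. §7 CERTIFIED FIRST MOVE OF A SIMPLIFIED CHAIN (positive content for provers). Lawden's
   substitution `x = √(1−t²)` (tree lemmas `lemniscaticK_subst_sqrt`, `lemniscaticE_subst_sqrt`)
   sends `k(x)dx ↦ √2dt/√(1−t⁴)` and `g(x)dx ↦ √2t²dt/√(1−t⁴)` EXACTLY — no exact `F′`-term, unlike
   McKean–Moll's `t² = 2x²/(1+x²)` of the grounder's plan (§6): `aTildeRep_sub_kRep_mem_changeOfVariablesRel`,
   `sTildeRep_sub_gRep_mem_changeOfVariablesRel` (ONE rule-(2) move each, via the general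
   `unitRep_sub_unitRep_mem_changeOfVariablesRel`), glued by the tree's `Equivalent.prod`:
   `equivalent_legendreRep_lemniscateRep : r₀ ~ [s̃]·[ã]` and
   `gpcLegendre_iff_lemniscate : crux ↔ Equivalent lemniscateRep arctanRep`
   (`lemniscateRep = [(0,1)², 2t₀²/(√(1−t₀⁴)√(1−t₁⁴))]`, value `π/2` = Euler 1738 by soundness).
   Remaining for a prover: `u = t⁴` (rule 2, each factor), Dirichlet's two polynomial substitutions
   (rule 2, dim 2), ONE Newton–Leibniz move (`∫₀¹ s^{-3/4}ds = 4`; one is necessary by §3) and the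
   arctangent bookkeeping — about seven moves.
8. §8 ADDITIVITY IS NECESSARY (modulo van den Dries Ch. 4 (2.4)): `domainEuler [r] = E(r.domain)`
   (o-minimal Euler characteristic, tree `eulerChar` + `real_isOMinimal_holds`) kills Newton–Leibniz
   moves unconditionally and change-of-variables moves modulo the named fact
   `Dries1998_ch4_prop_2_4` (vendored by this seat into `Literature/ModelTheory/ExponentialFields/
   OMinimalEulerInvariance.lean`, proposal pending); `E((0,1)²) − E(ℝ) = 2`, so
   `legendre_not_mem_closure_without_additivity` (mod (2.4)) and `legendre_not_mem_closure_newtonLeibniz`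
   (unconditional): with §3, every derivation uses rule (1) AND rule (3).
9. Targets: none handed over (no stuck stubs). Near-misses: none (no kill line exists, §5).
-/

noncomputable section

set_option linter.dupNamespace false

open MeasureTheory Set
open FirstOrder FirstOrder.Language
open Literature.NumberTheory.Transcendental
open Literature.NumberTheory.Transcendental.KZ
open Literature.ModelTheory.ExponentialFields
open Literature.ModelTheory.ExponentialFields.CellDimension
open MvPolynomial (aeval X C)
open Summit.KontsevichZagierPeriods.KontsevichZagierPeriods.Theses.Grothendieck (GpcLegendreLemniscatic)

namespace Summit.KontsevichZagierPeriods.KontsevichZagierPeriods.Cruxes.GpcLegendreLemniscatic.Disproof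

/-! ## §1 Vocabulary: the canonical representations -/

/-- `k(t) = 1/√((1 − t²)(1 − t²/2))`, the `K(1/√2)` integrand. [cite: Lawden1989, §3.1 eq. (3.1.3)] -/
def kFun (t : ℝ) : ℝ := 1 / Real.sqrt ((1 - t ^ 2) * (1 - t ^ 2 / 2))

/-- `e(t) = √(1 − t²/2)/√(1 − t²)`, the `E(1/√2)` integrand. [cite: Lawden1989, §3.8 eq. (3.8.3)] -/
def eFun (t : ℝ) : ℝ := Real.sqrt (1 - t ^ 2 / 2) / Real.sqrt (1 - t ^ 2)

/-- `g(t) = 2e(t) − k(t) = √(1 − t²)/√(1 − t²/2)` (on `(0,1)`), the first factor of the crux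
integrand `(2e(x₀) − k(x₀))·k(x₁)`. [folklore] -/
def gFun (t : ℝ) : ℝ := Real.sqrt (1 - t ^ 2) / Real.sqrt (1 - t ^ 2 / 2)

/-- The open unit interval as a subset of `ℝ¹`. [folklore] -/
def unitIoo : Set (Fin 1 → ℝ) := {x | x 0 ∈ Ioo (0:ℝ) 1}

/-- `unitIoo` is `ℚ`-semialgebraic. [folklore] -/
theorem isSemialgebraic_unitIoo : IsSemialgebraic ℚ unitIoo :=
  isSemialgebraic_unitInterval_fin_one

/-- `unitIoo` is the preimage of `(0,1)` under `ℝ¹ ≃ ℝ`. [folklore] -/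
theorem unitIoo_eq_preimage : unitIoo = MeasurableEquiv.funUnique (Fin 1) ℝ ⁻¹' Ioo 0 1 := by
  ext x
  simp [unitIoo, MeasurableEquiv.funUnique, Fin.default_eq_zero]

/-- The one-dimensional representation `[(0,1), h]` of a semialgebraic integrable `h`. [folklore] -/
def unitRep (h : ℝ → ℝ) (hh : IsSemialgebraicFunOn ℚ unitIoo (fun x => h (x 0)))
    (hint : IntegrableOn h (Ioo 0 1)) : IntegralRep 1 where
  domain := unitIoo
  integrand := fun x => h (x 0)
  isSemialgebraic_domain := isSemialgebraic_unitIoo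
  isSemialgebraicFunOn_integrand := hh
  integrableOn := by
    rw [unitIoo_eq_preimage]
    exact ((volume_preserving_funUnique (Fin 1) ℝ).integrableOn_comp_preimage
      (MeasurableEquiv.measurableEmbedding _)).mpr hint

/-- The domain of `unitRep`. [folklore] -/
@[simp] theorem unitRep_domain (h : ℝ → ℝ) (hh : IsSemialgebraicFunOn ℚ unitIoo (fun x => h (x 0)))
    (hint : IntegrableOn h (Ioo 0 1)) : (unitRep h hh hint).domain = unitIoo := rfl

/-- The integrand of `unitRep`. [folklore] -/
@[simp] theorem unitRep_integrand (h : ℝ → ℝ) (hh : IsSemialgebraicFunOn ℚ unitIoo (fun x => h (x 0)))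
    (hint : IntegrableOn h (Ioo 0 1)) : (unitRep h hh hint).integrand = fun x => h (x 0) := rfl

/-- The value of `unitRep h` is `∫_{(0,1)} h`. [folklore] -/
theorem unitRep_value (h : ℝ → ℝ) (hh : IsSemialgebraicFunOn ℚ unitIoo (fun x => h (x 0)))
    (hint : IntegrableOn h (Ioo 0 1)) : (unitRep h hh hint).value = ∫ t in Ioo (0:ℝ) 1, h t := by
  change ∫ x in unitIoo, h (x 0) = _
  rw [unitIoo_eq_preimage, ← (volume_preserving_funUnique (Fin 1) ℝ).setIntegral_preimage_emb
    (MeasurableEquiv.measurableEmbedding _) h (Ioo 0 1)]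
  rfl

/-- The radicand `(1 − t²)(1 − t²/2)` is positive on `(0,1)`. [folklore] -/
theorem radicand_pos {t : ℝ} (ht : t ∈ Ioo (0:ℝ) 1) : 0 < (1 - t ^ 2) * (1 - t ^ 2 / 2) := by
  have h1 : 0 < 1 - t ^ 2 := by nlinarith [ht.1, ht.2]
  have h2 : 0 < 1 - t ^ 2 / 2 := by nlinarith [ht.1, ht.2]
  exact mul_pos h1 h2

/-- `x ↦ 1 − x₀²` is semialgebraic on `unitIoo`. [folklore] -/
theorem isSemialgebraicFunOn_one_sub_sq :
    IsSemialgebraicFunOn ℚ unitIoo (fun x => 1 - x 0 ^ 2) := by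
  have := isSemialgebraicFunOn_aeval isSemialgebraic_unitIoo (1 - X 0 ^ 2 : MvPolynomial (Fin 1) ℚ)
  refine this.congr fun x _ => ?_
  simp

/-- `x ↦ 1 − x₀²/2` is semialgebraic on `unitIoo`. [folklore] -/
theorem isSemialgebraicFunOn_one_sub_sq_half :
    IsSemialgebraicFunOn ℚ unitIoo (fun x => 1 - x 0 ^ 2 / 2) := by
  have := isSemialgebraicFunOn_aeval isSemialgebraic_unitIoo
    (1 - X 0 ^ 2 * C (1 / 2 : ℚ) : MvPolynomial (Fin 1) ℚ)
  refine this.congr fun x _ => ?_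
  simp only [map_sub, map_one, map_mul, map_pow, MvPolynomial.aeval_X, MvPolynomial.aeval_C,
    eq_ratCast]
  push_cast
  ring

/-- `x ↦ k(x₀)` is semialgebraic on `unitIoo`. [folklore] -/
theorem isSemialgebraicFunOn_kFun : IsSemialgebraicFunOn ℚ unitIoo (fun x => kFun (x 0)) := by
  have hp := IsSemialgebraicFunOn.mul_holds isSemialgebraicFunOn_one_sub_sq
    isSemialgebraicFunOn_one_sub_sq_half
  have hsqrt := IsSemialgebraicFunOn.sqrt_holds hp
  have h1 := isSemialgebraicFunOn_ratCast isSemialgebraic_unitIoo 1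
  refine ((h1.div hsqrt) fun x hx => ?_).congr fun x _ => ?_
  · exact (Real.sqrt_pos.2 (radicand_pos hx)).ne'
  · simp [kFun]

/-- `x ↦ e(x₀)` is semialgebraic on `unitIoo`. [folklore] -/
theorem isSemialgebraicFunOn_eFun : IsSemialgebraicFunOn ℚ unitIoo (fun x => eFun (x 0)) := by
  have hn := IsSemialgebraicFunOn.sqrt_holds isSemialgebraicFunOn_one_sub_sq_half
  have hd := IsSemialgebraicFunOn.sqrt_holds isSemialgebraicFunOn_one_sub_sq
  refine ((hn.div hd) fun x hx => ?_).congr fun x _ => ?_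
  · exact (Real.sqrt_pos.2 (by have := hx.1; have := hx.2; nlinarith)).ne'
  · simp [eFun]

/-- `x ↦ g(x₀)` is semialgebraic on `unitIoo`. [folklore] -/
theorem isSemialgebraicFunOn_gFun : IsSemialgebraicFunOn ℚ unitIoo (fun x => gFun (x 0)) := by
  have hn := IsSemialgebraicFunOn.sqrt_holds isSemialgebraicFunOn_one_sub_sq
  have hd := IsSemialgebraicFunOn.sqrt_holds isSemialgebraicFunOn_one_sub_sq_half
  refine ((hn.div hd) fun x hx => ?_).congr fun x _ => ?_
  · exact (Real.sqrt_pos.2 (by have := hx.1; have := hx.2; nlinarith)).ne'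
  · simp [gFun]

/-- `k` is the tree's elliptic integrand of parameter `m = 1/2`. [folklore] -/
theorem kFun_eq_ellIntegrand (t : ℝ) :
    kFun t = Literature.Probability.RandomPlanarGeometry.ellIntegrand (1 / 2) t := by
  simp only [kFun, Literature.Probability.RandomPlanarGeometry.ellIntegrand]
  ring_nf

/-- `k` is integrable on `(0,1)` (singularity `(1−t)^{-1/2}` at `1`). [folklore] -/
theorem integrableOn_kFun : IntegrableOn kFun (Ioo 0 1) := by
  have h := Literature.Probability.RandomPlanarGeometry.intervalIntegrable_ellIntegrand
    (m := 1 / 2) (by norm_num) (by norm_num)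
  rw [intervalIntegrable_iff_integrableOn_Ioo_of_le zero_le_one] at h
  refine h.congr_fun (fun t _ => (kFun_eq_ellIntegrand t).symm) measurableSet_Ioo

/-- `e ≤ 1/√(1 − t²)` on `(0,1)`; `e` is integrable on `(0,1)`. [folklore] -/
theorem integrableOn_eFun : IntegrableOn eFun (Ioo 0 1) := by
  have h := Literature.Probability.RandomPlanarGeometry.intervalIntegrable_ellIntegrand
    (m := 0) le_rfl (by norm_num)
  rw [intervalIntegrable_iff_integrableOn_Ioo_of_le zero_le_one] at h
  refine h.mono' ?_ ?_
  · refine ContinuousOn.aestronglyMeasurable ?_ measurableSet_Ioo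
    refine ContinuousOn.div (by fun_prop) (by fun_prop) fun t ht => ?_
    exact (Real.sqrt_pos.2 (by nlinarith [ht.1, ht.2])).ne'
  · refine (ae_restrict_mem measurableSet_Ioo).mono fun t ht => ?_
    have h1 : 0 < 1 - t ^ 2 := by nlinarith [ht.1, ht.2]
    have hs : 0 < Real.sqrt (1 - t ^ 2) := Real.sqrt_pos.2 h1
    have hnum : Real.sqrt (1 - t ^ 2 / 2) ≤ 1 := by
      rw [Real.sqrt_le_one]
      nlinarith [ht.1]
    unfold eFun
    rw [Real.norm_eq_abs, abs_of_nonneg (div_nonneg (Real.sqrt_nonneg _) hs.le),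
      Literature.Probability.RandomPlanarGeometry.ellIntegrand, zero_mul, sub_zero, mul_one]
    exact div_le_div_of_nonneg_right hnum hs.le

/-- `g` is continuous on `[0,1]`, hence integrable on `(0,1)`. [folklore] -/
theorem integrableOn_gFun : IntegrableOn gFun (Ioo 0 1) := by
  have hc : ContinuousOn gFun (Icc 0 1) := by
    refine ContinuousOn.div (by fun_prop) (by fun_prop) fun t ht => ?_
    exact (Real.sqrt_pos.2 (by nlinarith [ht.1, ht.2])).ne'
  exact (hc.integrableOn_compact isCompact_Icc).mono_set Ioo_subset_Icc_self

/-- `[(0,1), k]`, value `K(1/√2)`. [cite: Lawden1989, §3.1 eq. (3.1.3)] -/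
def kRep : IntegralRep 1 := unitRep kFun isSemialgebraicFunOn_kFun integrableOn_kFun

/-- `[(0,1), e]`, value `E(1/√2)`. [cite: Lawden1989, §3.8 eq. (3.8.3)] -/
def eRep : IntegralRep 1 := unitRep eFun isSemialgebraicFunOn_eFun integrableOn_eFun

/-- `[(0,1), g]`, value `2E(1/√2) − K(1/√2)`. [folklore] -/
def gRep : IntegralRep 1 := unitRep gFun isSemialgebraicFunOn_gFun integrableOn_gFun

/-- `value [(0,1), k] = K(1/√2) = lemniscaticK`. [cite: Lawden1989, §3.1 eq. (3.1.3)] -/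
theorem kRep_value : kRep.value = Literature.Analysis.SpecialFunctions.lemniscaticK :=
  unitRep_value _ _ _

/-- `value [(0,1), e] = E(1/√2) = lemniscaticE`. [cite: Lawden1989, §3.8 eq. (3.8.3)] -/
theorem eRep_value : eRep.value = Literature.Analysis.SpecialFunctions.lemniscaticE :=
  unitRep_value _ _ _

/-- On `(0,1)`, `g = 2e − k`. [folklore] -/
theorem gFun_eq {t : ℝ} (ht : t ∈ Ioo (0:ℝ) 1) : gFun t = 2 * eFun t - kFun t := by
  have h1 : 0 < 1 - t ^ 2 := by nlinarith [ht.1, ht.2]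
  have h2 : 0 < 1 - t ^ 2 / 2 := by nlinarith [ht.1, ht.2]
  have hprod : Real.sqrt ((1 - t ^ 2) * (1 - t ^ 2 / 2)) =
      Real.sqrt (1 - t ^ 2) * Real.sqrt (1 - t ^ 2 / 2) := Real.sqrt_mul h1.le _
  unfold gFun eFun kFun
  rw [hprod]
  set a := Real.sqrt (1 - t ^ 2) with ha
  set b := Real.sqrt (1 - t ^ 2 / 2) with hb
  have ha0 : 0 < a := Real.sqrt_pos.2 h1
  have hb0 : 0 < b := Real.sqrt_pos.2 h2
  have ha2 : a ^ 2 = 1 - t ^ 2 := Real.sq_sqrt h1.le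
  have hb2 : b ^ 2 = 1 - t ^ 2 / 2 := Real.sq_sqrt h2.le
  field_simp
  linear_combination ha2 - 2 * hb2

/-- `value [(0,1), g] = 2E − K`. [folklore] -/
theorem gRep_value : gRep.value =
    2 * Literature.Analysis.SpecialFunctions.lemniscaticE - Literature.Analysis.SpecialFunctions.lemniscaticK := by
  rw [gRep, unitRep_value, setIntegral_congr_fun measurableSet_Ioo (fun t ht => gFun_eq ht),
    integral_sub (integrableOn_eFun.const_mul 2) integrableOn_kFun, integral_const_mul]
  rfl

/-- The open unit square `(0,1)²` in the crux's typing. [folklore] -/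
def unitSq : Set (Fin 2 → ℝ) := {x | ∀ i, x i ∈ Ioo (0:ℝ) 1}

/-- **The canonical left representation** `r₀ = [g] · [k] = [(0,1)², g(x₀)·k(x₁)]`, the Fubini
product of the two one-dimensional representations (value `(2E − K)·K`). [folklore] -/
def legendreRep : IntegralRep 2 := gRep.prod kRep

/-- Membership in the domain of `r₀`. [folklore] -/
theorem mem_legendreRep_domain (x : Fin 2 → ℝ) :
    x ∈ legendreRep.domain ↔ x 0 ∈ Ioo (0:ℝ) 1 ∧ x 1 ∈ Ioo (0:ℝ) 1 := Iff.rfl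

/-- The domain of `r₀` is the crux's `{x | ∀ i, x i ∈ (0,1)}`. [folklore] -/
theorem legendreRep_domain : legendreRep.domain = unitSq := by
  ext x
  rw [mem_legendreRep_domain]
  simp [unitSq, Fin.forall_fin_two]

/-- The integrand of `r₀` is `g(x₀)·k(x₁)`. [folklore] -/
theorem legendreRep_integrand_apply (x : Fin 2 → ℝ) :
    legendreRep.integrand x = gFun (x 0) * kFun (x 1) := by
  rw [show legendreRep = gRep.prod kRep from rfl, IntegralRep.prod_integrand_eq]
  rfl

/-- **Value of `r₀`**: `(2E − K)·K = 2EK − K² = π/2` (Fubini `IntegralRep.value_prod` and the tree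
theorem `Lawden1989_eq_3_8_29_lemniscatic_holds`, Legendre's relation at `k = k′ = 1/√2`).
[cite: Lawden1989, §3.8 eq. (3.8.29) and Ch. 3 Exercise 25] -/
theorem legendreRep_value : legendreRep.value = Real.pi / 2 := by
  rw [show legendreRep = gRep.prod kRep from rfl, IntegralRep.value_prod, gRep_value, kRep_value]
  have h := Literature.Analysis.SpecialFunctions.Lawden1989_eq_3_8_29_lemniscatic_holds
  unfold Literature.Analysis.SpecialFunctions.Lawden1989_eq_3_8_29_lemniscatic at h
  linear_combination h

/-- The crux's integrand formula, verbatim. [folklore] -/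
def cruxIntegrand (x : Fin 2 → ℝ) : ℝ :=
  2 * Real.sqrt (1 - x 0 ^ 2 / 2) / Real.sqrt (1 - x 0 ^ 2) / Real.sqrt ((1 - x 1 ^ 2) * (1 - x 1 ^ 2 / 2)) -
    1 / Real.sqrt ((1 - x 0 ^ 2) * (1 - x 0 ^ 2 / 2)) / Real.sqrt ((1 - x 1 ^ 2) * (1 - x 1 ^ 2 / 2))

/-- READBACK: on `(0,1)²` the crux's integrand is `(2e(x₀) − k(x₀))·k(x₁) = g(x₀)·k(x₁)`
(left-associated divisions as printed). [folklore] -/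
theorem cruxIntegrand_eq {x : Fin 2 → ℝ} (hx : x ∈ unitSq) :
    cruxIntegrand x = gFun (x 0) * kFun (x 1) := by
  rw [gFun_eq (hx 0)]
  unfold cruxIntegrand eFun kFun
  ring

/-- **The canonical right representation** `r₀' = [ℝ, 1/(2(1+x²))]` (value `π/2`). [folklore] -/
def arctanRep : IntegralRep 1 where
  domain := univ
  integrand := fun x => 1 / (2 * (1 + x 0 ^ 2))
  isSemialgebraic_domain := Literature.ModelTheory.ExponentialFields.isSemialgebraic_univ
  isSemialgebraicFunOn_integrand := by
    have hu : IsSemialgebraic ℚ (univ : Set (Fin 1 → ℝ)) :=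
      Literature.ModelTheory.ExponentialFields.isSemialgebraic_univ
    have h := isSemialgebraicFunOn_aeval_div_aeval hu
      (1 : MvPolynomial (Fin 1) ℚ) (2 * (1 + X 0 ^ 2)) (fun x _ => by
        simp only [map_mul, map_add, map_one, map_pow, MvPolynomial.aeval_X, map_ofNat]
        positivity)
    exact h.congr fun x _ => by
      simp only [map_mul, map_add, map_one, map_pow, MvPolynomial.aeval_X, map_ofNat]
  integrableOn := by
    rw [integrableOn_univ]
    have hg : Integrable (fun t : ℝ => 1 / (2 * (1 + t ^ 2))) := by
      have := integrable_inv_one_add_sq.const_mul (1 / 2 : ℝ)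
      refine this.congr (Filter.Eventually.of_forall fun t => ?_)
      simp only [one_div, mul_inv]
    exact ((volume_preserving_funUnique (Fin 1) ℝ).integrable_comp_emb
      (MeasurableEquiv.measurableEmbedding _)).mpr hg

/-- The domain of `r₀'`. [folklore] -/
@[simp] theorem arctanRep_domain : arctanRep.domain = univ := rfl

/-- The integrand of `r₀'`. [folklore] -/
@[simp] theorem arctanRep_integrand : arctanRep.integrand = fun x => 1 / (2 * (1 + x 0 ^ 2)) := rfl

/-- **Value of `r₀'`**: `∫_ℝ dx/(2(1+x²)) = π/2` (Mathlib `integral_univ_inv_one_add_sq`). [folklore] -/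
theorem arctanRep_value : arctanRep.value = Real.pi / 2 := by
  rw [IntegralRep.value, arctanRep_domain, Measure.restrict_univ, arctanRep_integrand]
  have h := (volume_preserving_funUnique (Fin 1) ℝ).integral_comp'
    (fun t : ℝ => 1 / (2 * (1 + t ^ 2)))
  simp only [MeasurableEquiv.funUnique] at h
  have h2 : ∫ t : ℝ, 1 / (2 * (1 + t ^ 2)) = Real.pi / 2 := by
    have : (fun t : ℝ => 1 / (2 * (1 + t ^ 2))) = fun t => (1 / 2 : ℝ) * (1 + t ^ 2)⁻¹ := by
      ext t
      simp only [one_div, mul_inv]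
    rw [this, integral_const_mul, integral_univ_inv_one_add_sq]
    ring
  rw [← h2, ← h]
  rfl

/-- NO EVALUATION KILL: the two canonical representations have the same value `π/2`
(so no additive invariant factoring through `KZ.eval` separates them). [folklore] -/
theorem legendreRep_value_eq_arctanRep_value : legendreRep.value = arctanRep.value := by
  rw [legendreRep_value, arctanRep_value]

/-- **Off-domain values and the `∀`-shape are harmless**: two representations with the same
domain whose integrands agree on it are equivalent — by ONE change of variables along the identity
(re-derivation of refuter g8-4's lemma of 2026-08-13, ledger note on the item). [folklore] -/
theorem equivalent_of_eqOn {n : ℕ} (r r' : IntegralRep n) (hd : r'.domain = r.domain)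
    (hf : EqOn r.integrand r'.integrand r.domain) : Equivalent r r' := by
  apply changeOfVariablesRel_subset_relations
  refine ⟨n, r, r', id, fun _ => ContinuousLinearMap.id ℝ _, isSemialgebraicMapOn_id r.isSemialgebraic_domain,
    fun x _ => hasFDerivWithinAt_id x _, injOn_id _, by simp [hd], ?_, rfl⟩
  intro x hx
  have : (ContinuousLinearMap.id ℝ (Fin n → ℝ)).det = 1 := by simp [ContinuousLinearMap.det]
  simp [hf hx, this]

/-- **Reduction to the canonical pair.** The crux is equivalent to its single instance
`[r₀] − [r₀'] ∈ KZ.relations`: every admissible `(r, r')` differs from `(r₀, r₀')` by identity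
moves (`equivalent_of_eqOn`), and conversely `(r₀, r₀')` is admissible. In particular the
hypotheses are satisfiable (NO VACUITY) and the `∀ r r'` shape adds nothing. [folklore] -/
theorem gpcLegendre_iff : GpcLegendreLemniscatic ↔ Equivalent legendreRep arctanRep := by
  constructor
  · intro h
    refine h legendreRep arctanRep legendreRep_domain (fun x hx => ?_) rfl (fun x _ => rfl)
    rw [legendreRep_domain] at hx
    exact (legendreRep_integrand_apply x).trans (cruxIntegrand_eq hx).symm
  · intro h r r' hd hf hd' hf'
    have h1 : Equivalent r legendreRep := by
      refine equivalent_of_eqOn r legendreRep (legendreRep_domain.trans hd.symm) fun x hx => ?_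
      have hx' : x ∈ unitSq := by rw [hd] at hx; exact hx
      rw [legendreRep_integrand_apply, ← cruxIntegrand_eq hx']
      exact hf hx
    have h2 : Equivalent arctanRep r' := by
      refine equivalent_of_eqOn arctanRep r' (show r'.domain = arctanRep.domain from hd') fun x _ => ?_
      have hx : x ∈ r'.domain := by rw [hd']; trivial
      show arctanRep.integrand x = r'.integrand x
      exact (hf' hx).symm
    exact h1.trans (h.trans h2)

/-! ## §2 Load-bearing hypotheses: each of the four pinning hypotheses is necessary

The crux has four hypotheses: `hD : r.domain = (0,1)²`, `hF : r.integrand = crux integrand on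
the domain`, `hD' : r'.domain = ℝ`, `hF' : r'.integrand = 1/(2(1+x²)) on the domain`. Dropping
any one of them gives a FALSE statement (witness: an empty-domain or zero-integrand
representation, separated by `KZ.eval` through the proved soundness
`KZ.Equivalent.value_eq_holds`). So all four are load-bearing — as expected, since each pins a
value. -/

/-- The empty representation in dimension `n` (value `0`). [folklore] -/
def emptyRep (n : ℕ) : IntegralRep n where
  domain := ∅
  integrand := fun _ => 0
  isSemialgebraic_domain := Literature.ModelTheory.ExponentialFields.isSemialgebraic_empty
  isSemialgebraicFunOn_integrand :=
    (isSemialgebraicFunOn_ratCast (m := n)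
      (Literature.ModelTheory.ExponentialFields.isSemialgebraic_univ) 0).mono (empty_subset _)
      Literature.ModelTheory.ExponentialFields.isSemialgebraic_empty |>.congr fun x _ => by simp
  integrableOn := integrableOn_empty

/-- The empty representation has value `0`. [folklore] -/
@[simp] theorem emptyRep_value (n : ℕ) : (emptyRep n).value = 0 := by
  simp [IntegralRep.value, emptyRep]

/-- The zero representation on a semialgebraic domain (value `0`). [folklore] -/
def zeroRep {n : ℕ} (σ : Set (Fin n → ℝ)) (hσ : IsSemialgebraic ℚ σ) : IntegralRep n where
  domain := σ
  integrand := fun _ => 0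
  isSemialgebraic_domain := hσ
  isSemialgebraicFunOn_integrand := (isSemialgebraicFunOn_ratCast hσ 0).congr fun x _ => by simp
  integrableOn := integrableOn_zero

/-- The zero representation has value `0`. [folklore] -/
@[simp] theorem zeroRep_value {n : ℕ} (σ : Set (Fin n → ℝ)) (hσ : IsSemialgebraic ℚ σ) :
    (zeroRep σ hσ).value = 0 := by
  simp [IntegralRep.value, zeroRep]

/-- `(0,1)²` is `ℚ`-semialgebraic. [folklore] -/
theorem isSemialgebraic_unitSq : IsSemialgebraic ℚ unitSq :=
  legendreRep_domain ▸ legendreRep.isSemialgebraic_domain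

/-- The crux with `hD : r.domain = (0,1)²` dropped. [folklore] -/
def WithoutDomainL : Prop :=
  ∀ (r : IntegralRep 2) (r' : IntegralRep 1), EqOn r.integrand cruxIntegrand r.domain →
    r'.domain = univ → EqOn r'.integrand (fun x => 1 / (2 * (1 + x 0 ^ 2))) r'.domain → Equivalent r r'

/-- The crux with `hF : r.integrand = …` dropped. [folklore] -/
def WithoutIntegrandL : Prop :=
  ∀ (r : IntegralRep 2) (r' : IntegralRep 1), r.domain = unitSq →
    r'.domain = univ → EqOn r'.integrand (fun x => 1 / (2 * (1 + x 0 ^ 2))) r'.domain → Equivalent r r'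

/-- The crux with `hD' : r'.domain = ℝ` dropped. [folklore] -/
def WithoutDomainR : Prop :=
  ∀ (r : IntegralRep 2) (r' : IntegralRep 1), r.domain = unitSq → EqOn r.integrand cruxIntegrand r.domain →
    EqOn r'.integrand (fun x => 1 / (2 * (1 + x 0 ^ 2))) r'.domain → Equivalent r r'

/-- The crux with `hF' : r'.integrand = 1/(2(1+x²))` dropped. [folklore] -/
def WithoutIntegrandR : Prop :=
  ∀ (r : IntegralRep 2) (r' : IntegralRep 1), r.domain = unitSq → EqOn r.integrand cruxIntegrand r.domain →
    r'.domain = univ → Equivalent r r'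

/-- Sanity: the crux is the conjunction-shape of the four hypotheses (definitional unfolding). [folklore] -/
theorem gpcLegendre_iff_pinned : GpcLegendreLemniscatic ↔
    ∀ (r : IntegralRep 2) (r' : IntegralRep 1), r.domain = unitSq → EqOn r.integrand cruxIntegrand r.domain →
      r'.domain = univ → EqOn r'.integrand (fun x => 1 / (2 * (1 + x 0 ^ 2))) r'.domain → Equivalent r r' :=
  Iff.rfl

/-- `π/2 ≠ 0`. [folklore] -/
theorem pi_div_two_ne_zero : Real.pi / 2 ≠ 0 := by positivity

/-- **`hD` is load-bearing**: witness `r = [∅, 0]` (value `0`) against `r₀'` (value `π/2`). [folklore] -/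
theorem gpcLegendre_false_without_domainL : ¬ WithoutDomainL := by
  intro h
  have hE := h (emptyRep 2) arctanRep (fun x hx => hx.elim) rfl (fun x _ => rfl)
  have hv := Equivalent.value_eq_holds hE
  rw [emptyRep_value, arctanRep_value] at hv
  exact pi_div_two_ne_zero hv.symm

/-- **`hF` is load-bearing**: witness `r = [(0,1)², 0]` (value `0`) against `r₀'`. [folklore] -/
theorem gpcLegendre_false_without_integrandL : ¬ WithoutIntegrandL := by
  intro h
  have hE := h (zeroRep unitSq isSemialgebraic_unitSq) arctanRep rfl rfl (fun x _ => rfl)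
  have hv := Equivalent.value_eq_holds hE
  rw [zeroRep_value, arctanRep_value] at hv
  exact pi_div_two_ne_zero hv.symm

/-- **`hD'` is load-bearing**: witness `r' = [∅, 0]` (value `0`) against `r₀` (value `π/2`). [folklore] -/
theorem gpcLegendre_false_without_domainR : ¬ WithoutDomainR := by
  intro h
  have hE := h legendreRep (emptyRep 1) legendreRep_domain
    (fun x hx => (legendreRep_integrand_apply x).trans
      (cruxIntegrand_eq (by rw [legendreRep_domain] at hx; exact hx)).symm)
    (fun x hx => hx.elim)
  have hv := Equivalent.value_eq_holds hE
  rw [emptyRep_value, legendreRep_value] at hv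
  exact pi_div_two_ne_zero hv

/-- **`hF'` is load-bearing**: witness `r' = [ℝ, 0]` (value `0`) against `r₀`. [folklore] -/
theorem gpcLegendre_false_without_integrandR : ¬ WithoutIntegrandR := by
  intro h
  have hE := h legendreRep (zeroRep univ Literature.ModelTheory.ExponentialFields.isSemialgebraic_univ)
    legendreRep_domain
    (fun x hx => (legendreRep_integrand_apply x).trans
      (cruxIntegrand_eq (by rw [legendreRep_domain] at hx; exact hx)).symm) rfl
  have hv := Equivalent.value_eq_holds hE
  rw [zeroRep_value, legendreRep_value] at hv
  exact pi_div_two_ne_zero hv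

/-! ## §3 Which moves are necessary: Newton–Leibniz (proved) and additivity (o-minimal χ, informal)

`dimProj d` keeps the generators of dimension `d`. The three SAME-DIMENSION moves (1a), (1b), (2)
are homogeneous, so `eval ∘ dimProj d` kills the subgroup they generate, for every `d`; the
Newton–Leibniz move (3) is the only move mixing dimensions. Since `[r₀] − [r₀']` has
`eval (dimProj 2 ·) = value r₀ = π/2 ≠ 0`, **every derivation of the crux uses rule (3)** (as the
planned chain does: two NL moves, the `F′`-cancellation and `B(1, ¼) = 4`).

ADDITIVITY IS NECESSARY TOO (not formalised — no o-minimal Euler characteristic in Mathlib): the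
o-minimal Euler characteristic `χ(domain)` is invariant under rule (2) (a semialgebraic bijection
`σ → Φ(σ)`, van den Dries 1998 Ch. 4 (2.4)) and under rule (3) (a band with closed bounded fibres
over `τ` has `χ = χ(τ)`), but `χ((0,1)²) = 1 ≠ −1 = χ(ℝ)`; so `[r₀] − [r₀'] ∉ closure(rules 2, 3)`
and some additivity move (1a)/(1b) must occur (the chain uses (1b) to split off the exact term and
(1a) for null-set adjustments and `ℝ = (−∞,0] ∪ [0,∞)`). The cheap substitutes fail: `KZ.coeffSum`
vanishes on `[r₀] − [r₀']`, and connectedness / compactness of the domain are not rule-(2)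
invariants (`(0,1) ∪ [2,3) → (0,2)`, `t ↦ t, t − 1` is an admissible change of variables). -/

/-- Projection of a formal combination onto its dimension-`d` part. [folklore] -/
def dimProj (d : ℕ) : FormalRep →+ FormalRep :=
  FreeAbelianGroup.lift fun p => if p.1 = d then FreeAbelianGroup.of p else 0

/-- `dimProj` on a generator. [folklore] -/
theorem dimProj_of {n : ℕ} (d : ℕ) (r : IntegralRep n) :
    dimProj d (of r) = if n = d then of r else 0 := by
  simp only [dimProj, of, FreeAbelianGroup.lift_apply_of]

/-- A homogeneous three-term combination projects to itself or to `0`. [folklore] -/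
theorem dimProj_sub_sub {n : ℕ} (d : ℕ) (r r₁ r₂ : IntegralRep n) :
    dimProj d (of r - of r₁ - of r₂) = if n = d then of r - of r₁ - of r₂ else 0 := by
  simp only [map_sub, dimProj_of]
  split_ifs <;> simp

/-- A homogeneous two-term combination projects to itself or to `0`. [folklore] -/
theorem dimProj_sub {n : ℕ} (d : ℕ) (r r' : IntegralRep n) :
    dimProj d (of r - of r') = if n = d then of r - of r' else 0 := by
  simp only [map_sub, dimProj_of]
  split_ifs <;> simp

/-- **Rules (1a), (1b), (2) preserve `eval ∘ dimProj d`** for every dimension `d`. [folklore] -/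
theorem closure_sameDim_le_ker (d : ℕ) :
    AddSubgroup.closure (domainAddRel ∪ integrandAddRel ∪ changeOfVariablesRel) ≤
      (eval.comp (dimProj d)).ker := by
  refine (AddSubgroup.closure_le _).mpr ?_
  rintro c ((hc | hc) | hc) <;> simp only [SetLike.mem_coe, AddMonoidHom.mem_ker, AddMonoidHom.coe_comp,
    Function.comp_apply]
  · obtain ⟨n, r, r₁, r₂, h1, h2, h3, h4, rfl⟩ := hc
    rw [dimProj_sub_sub]
    split_ifs
    · exact eval_eq_zero_of_mem_domainAddRel_holds ⟨n, r, r₁, r₂, h1, h2, h3, h4, rfl⟩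
    · simp
  · obtain ⟨n, r, r₁, r₂, h1, h2, h3, rfl⟩ := hc
    rw [dimProj_sub_sub]
    split_ifs
    · exact eval_eq_zero_of_mem_integrandAddRel_holds ⟨n, r, r₁, r₂, h1, h2, h3, rfl⟩
    · simp
  · obtain ⟨n, r, r', Φ, Φ', h1, h2, h3, h4, h5, rfl⟩ := hc
    rw [dimProj_sub]
    split_ifs
    · exact eval_eq_zero_of_mem_changeOfVariablesRel_holds ⟨n, r, r', Φ, Φ', h1, h2, h3, h4, h5, rfl⟩
    · simp

/-- `eval (dimProj 2 ([r₀] − [r₀'])) = π/2`. [folklore] -/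
theorem eval_dimProj_two_legendre :
    eval (dimProj 2 (of legendreRep - of arctanRep)) = Real.pi / 2 := by
  rw [map_sub, dimProj_of, dimProj_of]
  simp [legendreRep_value]

/-- **Newton–Leibniz is necessary**: `[r₀] − [r₀']` is NOT in the subgroup generated by the
additivity and change-of-variables moves alone (rules (1a), (1b), (2)); every derivation of the crux
contains a rule-(3) move. [folklore] -/
theorem legendre_not_mem_closure_without_newtonLeibniz :
    of legendreRep - of arctanRep ∉
      AddSubgroup.closure (domainAddRel ∪ integrandAddRel ∪ changeOfVariablesRel) := by
  intro h
  have h0 := closure_sameDim_le_ker 2 h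
  rw [AddMonoidHom.mem_ker, AddMonoidHom.coe_comp, Function.comp_apply, eval_dimProj_two_legendre] at h0
  exact pi_div_two_ne_zero h0

/-- The same for ANY admissible left representation of the crux against ANY one-dimensional
`r'` whatsoever (the hypotheses on `r'` are not even needed: MUTATION finding). [folklore] -/
theorem not_mem_closure_without_newtonLeibniz (r : IntegralRep 2) (r' : IntegralRep 1)
    (hd : r.domain = unitSq) (hf : EqOn r.integrand cruxIntegrand r.domain) :
    of r - of r' ∉ AddSubgroup.closure (domainAddRel ∪ integrandAddRel ∪ changeOfVariablesRel) := by
  intro h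
  have h0 := closure_sameDim_le_ker 2 h
  rw [AddMonoidHom.mem_ker, AddMonoidHom.coe_comp, Function.comp_apply, map_sub, dimProj_of,
    dimProj_of] at h0
  simp only [↓reduceIte, OfNat.one_ne_ofNat, eval_of, sub_zero] at h0
  have h1 : r.value = legendreRep.value := by
    refine Equivalent.value_eq_holds (equivalent_of_eqOn r legendreRep (legendreRep_domain.trans hd.symm) ?_)
    intro x hx
    have hx' : x ∈ unitSq := by rw [hd] at hx; exact hx
    rw [legendreRep_integrand_apply, ← cruxIntegrand_eq hx']
    exact hf hx
  rw [h1, legendreRep_value] at h0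
  exact pi_div_two_ne_zero h0

/-! ## §4 Refuted strengthenings / natural variants

* §4.1 NO TERMWISE TRANSFER. `r₀ = 2[e ⊗ k] − [k ⊗ k]` modulo integrand additivity, but neither
  summand is separately equivalent to a rational multiple of `[ℝ, 1/(1+x²)]`: their values `2EK`
  and `K²` are not in `ℚπ` (Chudnovsky: `π`, `Γ(¼)` algebraically independent — tree theorem
  `algebraicIndependent_real_pi_gamma_one_quarter` — and `K = Γ(¼)²/(4√π)`, tree theorem
  `Lawden1989_eq_4_3_6_holds`). So a derivation must MIX the `E`- and `K`-parts before descending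
  in dimension (the planned chain does: `2e − k = g` is combined pointwise, and the exact term
  `F′(x₀)/√(1−x₁⁴)` that is split off has value `0`). More generally the only `ℚ`-relations
  `a·EK + b·K² = q·π` are the multiples of Legendre's `(a, b, q) = (2, −1, ½)` (same computation).
* §4.2 THE SELF-DUAL MODULUS IS LOAD-BEARING. The same shape at parameter `m = k²`,
  `LegendreShape m` (`2e_m(x₀)k_m(x₁) − k_m(x₀)k_m(x₁)` against `[ℝ, 1/(2(1+x²))]`), is the crux at
  `m = ½` (`legendreShape_half_iff`) and is FALSE at `m = 0` (`not_legendreShape_zero`: value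
  `(π/2)² ≠ π/2`). By value it is false at every `m ∈ [0,1) ∖ {½}`: `m ↦ 2E_mK_m − K_m²` is strictly
  decreasing (`d/dm = E(E − K)/(m(1 − m)) < 0`; route ZeroPortrait items 12735
  `LegendrePencilStrictAnti` / 11726 `PencilPortrait`, tree `LegendreRelation.hasDerivAt_Kt/Et`),
  from `π²/4` at `m = 0` to `−∞` at `m → 1`; and it is VACUOUSLY TRUE at `m = 1` (`k₁ = 1/(1−t²)`
  is not integrable, so no admissible `r` exists). Only the CM point `m = ½` (where `K′ = K`,
  `E′ = E` turn Legendre's `EK′ + E′K − KK′ = π/2` into a relation inside `ℤ[K, E, π]`) is a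
  non-vacuous true instance — consistent with the sector philosophy of the route. -/

/-- `[ℝ, q/(1+x²)]`, value `q·π`. [folklore] -/
def ratArctanRep (q : ℚ) : IntegralRep 1 where
  domain := univ
  integrand := fun x => (q : ℝ) / (1 + x 0 ^ 2)
  isSemialgebraic_domain := Literature.ModelTheory.ExponentialFields.isSemialgebraic_univ
  isSemialgebraicFunOn_integrand := by
    have hu : IsSemialgebraic ℚ (univ : Set (Fin 1 → ℝ)) :=
      Literature.ModelTheory.ExponentialFields.isSemialgebraic_univ
    have h := isSemialgebraicFunOn_aeval_div_aeval hu
      (C q : MvPolynomial (Fin 1) ℚ) (1 + X 0 ^ 2) (fun x _ => by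
        simp only [map_add, map_one, map_pow, MvPolynomial.aeval_X]
        positivity)
    exact h.congr fun x _ => by
      simp only [map_add, map_one, map_pow, MvPolynomial.aeval_X, MvPolynomial.aeval_C, eq_ratCast]
  integrableOn := by
    rw [integrableOn_univ]
    have hg : Integrable (fun t : ℝ => (q : ℝ) / (1 + t ^ 2)) := by
      have := integrable_inv_one_add_sq.const_mul (q : ℝ)
      refine this.congr (Filter.Eventually.of_forall fun t => ?_)
      simp only [div_eq_mul_inv]
    exact ((volume_preserving_funUnique (Fin 1) ℝ).integrable_comp_emb
      (MeasurableEquiv.measurableEmbedding _)).mpr hg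

/-- `value [ℝ, q/(1+x²)] = q·π`. [folklore] -/
theorem ratArctanRep_value (q : ℚ) : (ratArctanRep q).value = q * Real.pi := by
  rw [IntegralRep.value, show (ratArctanRep q).domain = univ from rfl, Measure.restrict_univ,
    show (ratArctanRep q).integrand = fun x => (q : ℝ) / (1 + x 0 ^ 2) from rfl]
  have h := (volume_preserving_funUnique (Fin 1) ℝ).integral_comp'
    (fun t : ℝ => (q : ℝ) / (1 + t ^ 2))
  simp only [MeasurableEquiv.funUnique] at h
  have h2 : ∫ t : ℝ, (q : ℝ) / (1 + t ^ 2) = q * Real.pi := by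
    have : (fun t : ℝ => (q : ℝ) / (1 + t ^ 2)) = fun t => (q : ℝ) * (1 + t ^ 2)⁻¹ := by
      ext t
      simp only [div_eq_mul_inv]
    rw [this, integral_const_mul, integral_univ_inv_one_add_sq]
  rw [← h2, ← h]
  rfl

/-- `[k] · [k] = [(0,1)², k(x₀)k(x₁)]`, value `K²`. [folklore] -/
def kkRep : IntegralRep 2 := kRep.prod kRep

/-- `[e] · [k] = [(0,1)², e(x₀)k(x₁)]`, value `EK`. [folklore] -/
def ekRep : IntegralRep 2 := eRep.prod kRep

/-- `value ([k]·[k]) = K²`. [folklore] -/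
theorem kkRep_value : kkRep.value = Literature.Analysis.SpecialFunctions.lemniscaticK ^ 2 := by
  rw [show kkRep = kRep.prod kRep from rfl, IntegralRep.value_prod, kRep_value, sq]

/-- `value ([e]·[k]) = EK`. [folklore] -/
theorem ekRep_value : ekRep.value =
    Literature.Analysis.SpecialFunctions.lemniscaticE * Literature.Analysis.SpecialFunctions.lemniscaticK := by
  rw [show ekRep = eRep.prod kRep from rfl, IntegralRep.value_prod, kRep_value, eRep_value]

/-- `K(1/√2)² = Γ(¼)⁴/(16π)` (from Lawden (4.3.6), tree theorem). [cite: Lawden1989, §4.3 eq. (4.3.6)] -/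
theorem lemniscaticK_sq :
    Literature.Analysis.SpecialFunctions.lemniscaticK ^ 2 = Real.Gamma (1 / 4) ^ 4 / (16 * Real.pi) := by
  have h := Literature.Analysis.SpecialFunctions.Lawden1989_eq_4_3_6_holds
  unfold Literature.Analysis.SpecialFunctions.Lawden1989_eq_4_3_6 at h
  rw [h, div_pow, mul_pow, ← pow_mul, Real.sq_sqrt Real.pi_pos.le]
  norm_num

/-- **Chudnovsky, in the form used here**: `Γ(¼)⁴ ≠ c·π²` for every rational `c` (from the tree
theorem `algebraicIndependent_real_pi_gamma_one_quarter`). [cite: Chudnovsky1984, Ch. 7 §2 Corollary 2.3 (p. 307)] -/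
theorem gamma_quarter_pow_four_ne_rat_mul_pi_sq (c : ℚ) :
    Real.Gamma (1 / 4) ^ 4 ≠ c * Real.pi ^ 2 := by
  intro hc
  have hind := algebraicIndependent_real_pi_gamma_one_quarter
  rw [algebraicIndependent_iff] at hind
  have hP := hind (X 1 ^ 4 - C c * X 0 ^ 2) (by
    simp only [map_sub, map_mul, map_pow, MvPolynomial.aeval_X, MvPolynomial.aeval_C, eq_ratCast,
      Matrix.cons_val_one, Matrix.cons_val_zero, Matrix.cons_val_fin_one]
    rw [hc]
    ring)
  have h01 := congrArg (MvPolynomial.aeval ![(0 : ℝ), 1]) hP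
  simp at h01

/-- **§4.1a `[k]·[k]` is not transferable alone**: for no rational `q` is `[(0,1)², k(x₀)k(x₁)]`
equivalent to `[ℝ, q/(1+x²)]` (`K² = qπ` would give `Γ(¼)⁴ = 16q·π²`). [folklore] -/
theorem not_equivalent_kk_ratArctan (q : ℚ) : ¬ Equivalent kkRep (ratArctanRep q) := by
  intro h
  have hv := Equivalent.value_eq_holds h
  rw [kkRep_value, ratArctanRep_value, lemniscaticK_sq] at hv
  apply gamma_quarter_pow_four_ne_rat_mul_pi_sq (16 * q)
  have hπ := Real.pi_pos
  field_simp at hv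
  push_cast
  linear_combination hv

/-- **§4.1b `[e]·[k]` is not transferable alone**: for no rational `q` is `[(0,1)², e(x₀)k(x₁)]`
equivalent to `[ℝ, q/(1+x²)]` (`EK = qπ` with `4EK = 2K² + π` would give `Γ(¼)⁴ = (32q − 8)π²`). [folklore] -/
theorem not_equivalent_ek_ratArctan (q : ℚ) : ¬ Equivalent ekRep (ratArctanRep q) := by
  intro h
  have hv := Equivalent.value_eq_holds h
  rw [ekRep_value, ratArctanRep_value] at hv
  have hL := Literature.Analysis.SpecialFunctions.Lawden1989_eq_3_8_29_lemniscatic_holds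
  unfold Literature.Analysis.SpecialFunctions.Lawden1989_eq_3_8_29_lemniscatic at hL
  have hK2 := lemniscaticK_sq
  apply gamma_quarter_pow_four_ne_rat_mul_pi_sq (32 * q - 8)
  have hπ := Real.pi_pos
  -- `2EK − K² = π/2`, `EK = qπ` ⇒ `K² = 2qπ − π/2` ⇒ `Γ⁴/(16π) = (2q − ½)π`
  have hK : Literature.Analysis.SpecialFunctions.lemniscaticK ^ 2 = (2 * q - 1 / 2) * Real.pi := by
    linear_combination 2 * hv - hL
  rw [hK] at hK2
  field_simp at hK2
  push_cast
  linear_combination (-1 / 2 : ℝ) * hK2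

/-- The domain of a product of two unit-interval representations is `(0,1)²`. [folklore] -/
theorem prod_unitRep_domain (f g : ℝ → ℝ) (hf : IsSemialgebraicFunOn ℚ unitIoo (fun x => f (x 0)))
    (hfi : IntegrableOn f (Ioo 0 1)) (hg : IsSemialgebraicFunOn ℚ unitIoo (fun x => g (x 0)))
    (hgi : IntegrableOn g (Ioo 0 1)) : ((unitRep f hf hfi).prod (unitRep g hg hgi)).domain = unitSq := by
  ext x
  change x 0 ∈ Ioo (0:ℝ) 1 ∧ x 1 ∈ Ioo (0:ℝ) 1 ↔ _
  simp [unitSq, Fin.forall_fin_two]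

/-- The integrand of a product of two unit-interval representations is `f(x₀)g(x₁)`. [folklore] -/
theorem prod_unitRep_integrand_apply (f g : ℝ → ℝ) (hf : IsSemialgebraicFunOn ℚ unitIoo (fun x => f (x 0)))
    (hfi : IntegrableOn f (Ioo 0 1)) (hg : IsSemialgebraicFunOn ℚ unitIoo (fun x => g (x 0)))
    (hgi : IntegrableOn g (Ioo 0 1)) (x : Fin 2 → ℝ) :
    ((unitRep f hf hfi).prod (unitRep g hg hgi)).integrand x = f (x 0) * g (x 1) := by
  rw [IntegralRep.prod_integrand_eq]
  rfl

/-- The crux's shape at parameter `m = k²` (self-dual form `2e_m k_m − k_m k_m`, same right side).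
[folklore] -/
def LegendreShape (m : ℝ) : Prop :=
  ∀ (r : IntegralRep 2) (r' : IntegralRep 1), r.domain = unitSq →
    EqOn r.integrand (fun x => 2 * Real.sqrt (1 - m * x 0 ^ 2) / Real.sqrt (1 - x 0 ^ 2) /
        Real.sqrt ((1 - x 1 ^ 2) * (1 - m * x 1 ^ 2)) -
      1 / Real.sqrt ((1 - x 0 ^ 2) * (1 - m * x 0 ^ 2)) / Real.sqrt ((1 - x 1 ^ 2) * (1 - m * x 1 ^ 2)))
      r.domain →
    r'.domain = univ → EqOn r'.integrand (fun x => 1 / (2 * (1 + x 0 ^ 2))) r'.domain → Equivalent r r'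

/-- At `m = ½` the shape is the crux (syntactic variant `½·x²` of `x²/2`). [folklore] -/
theorem legendreShape_half_iff : LegendreShape (1 / 2) ↔ GpcLegendreLemniscatic := by
  have hfun : (fun x : Fin 2 → ℝ => 2 * Real.sqrt (1 - 1 / 2 * x 0 ^ 2) / Real.sqrt (1 - x 0 ^ 2) /
        Real.sqrt ((1 - x 1 ^ 2) * (1 - 1 / 2 * x 1 ^ 2)) -
      1 / Real.sqrt ((1 - x 0 ^ 2) * (1 - 1 / 2 * x 0 ^ 2)) / Real.sqrt ((1 - x 1 ^ 2) * (1 - 1 / 2 * x 1 ^ 2))) =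
      cruxIntegrand := by
    funext x
    simp only [cruxIntegrand]
    ring_nf
  unfold LegendreShape
  rw [hfun]
  exact Iff.rfl

/-- `a(t) = 1/√(1 − t²)`, the `K(0) = E(0) = π/2` integrand. [folklore] -/
def aFun (t : ℝ) : ℝ := 1 / Real.sqrt (1 - t ^ 2)

/-- `x ↦ a(x₀)` is semialgebraic on `unitIoo`. [folklore] -/
theorem isSemialgebraicFunOn_aFun : IsSemialgebraicFunOn ℚ unitIoo (fun x => aFun (x 0)) := by
  have hsqrt := IsSemialgebraicFunOn.sqrt_holds isSemialgebraicFunOn_one_sub_sq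
  have h1 := isSemialgebraicFunOn_ratCast isSemialgebraic_unitIoo 1
  refine ((h1.div hsqrt) fun x hx => ?_).congr fun x _ => ?_
  · exact (Real.sqrt_pos.2 (by have := hx.1; have := hx.2; nlinarith)).ne'
  · simp [aFun]

/-- `a` is the tree's elliptic integrand of parameter `0`. [folklore] -/
theorem aFun_eq_ellIntegrand (t : ℝ) :
    aFun t = Literature.Probability.RandomPlanarGeometry.ellIntegrand 0 t := by
  simp [aFun, Literature.Probability.RandomPlanarGeometry.ellIntegrand]

/-- `a` is integrable on `(0,1)`. [folklore] -/
theorem integrableOn_aFun : IntegrableOn aFun (Ioo 0 1) := by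
  have h := Literature.Probability.RandomPlanarGeometry.intervalIntegrable_ellIntegrand
    (m := 0) le_rfl (by norm_num)
  rw [intervalIntegrable_iff_integrableOn_Ioo_of_le zero_le_one] at h
  exact h.congr_fun (fun t _ => (aFun_eq_ellIntegrand t).symm) measurableSet_Ioo

/-- `[(0,1), a]`, value `K(0) = π/2`. [folklore] -/
def aRep : IntegralRep 1 := unitRep aFun isSemialgebraicFunOn_aFun integrableOn_aFun

/-- `value [(0,1), a] = π/2` (tree theorem `ellipticK_zero`). [folklore] -/
theorem aRep_value : aRep.value = Real.pi / 2 := by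
  rw [aRep, unitRep_value, ← Literature.Probability.RandomPlanarGeometry.ellipticK_zero,
    Literature.Probability.RandomPlanarGeometry.ellipticK, intervalIntegral.integral_of_le zero_le_one,
    integral_Ioc_eq_integral_Ioo]
  refine setIntegral_congr_fun measurableSet_Ioo fun t _ => ?_
  simp [aFun]

/-- **§4.2 The shape is false at `m = 0`** (witness `[a]·[a]`, value `(π/2)² ≠ π/2`): the self-dual
point `K′ = K`, `E′ = E` (`m = ½`) is load-bearing. [folklore] -/
theorem not_legendreShape_zero : ¬ LegendreShape 0 := by
  intro h
  have hE := h (aRep.prod aRep) arctanRep (prod_unitRep_domain _ _ _ _ _ _) (fun x hx => ?_) rfl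
    (fun x _ => rfl)
  · have hv := Equivalent.value_eq_holds hE
    rw [IntegralRep.value_prod, aRep_value, arctanRep_value] at hv
    have hπ := Real.pi_gt_three
    nlinarith [hv, hπ]
  · rw [show aRep.prod aRep = (unitRep aFun isSemialgebraicFunOn_aFun integrableOn_aFun).prod
      (unitRep aFun isSemialgebraicFunOn_aFun integrableOn_aFun) from rfl, prod_unitRep_integrand_apply]
    simp only [aFun, zero_mul, sub_zero, Real.sqrt_one, mul_one]
    ring

/-! ## §5 Why it resists: the crux is a CONSEQUENCE of the summit statement

`r₀'` has KZ's literal rational shape, and `r₀` is equivalent to SOME rational representation by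
the tree theorem `KZ.exists_isRational_equivalent_holds` ("algebraic integrands give the same
periods", KZ §1.1, proved via Tarski–Seidenberg); values agree (`legendreRep_value_eq_arctanRep_value`,
i.e. Legendre's relation, proved). Hence Conjecture 1 as typed (`KontsevichZagierPeriods`) IMPLIES the
crux. Contrapositive: **a refutation of this crux would refute the summit statement itself** — the
only possible weapon is a new additive invariant of the full four-move calculus vanishing on
`KZ.relations` and separating two representations of equal value, i.e. a disproof of the
Kontsevich–Zagier period conjecture in this calculus. No cheap kill exists. -/

/-- `r₀' = [ℝ, 1/(2(1+x²))]` has KZ's literal rational shape. [cite: KontsevichZagier2001, §1.1 Definition] -/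
theorem arctanRep_isRational : arctanRep.IsRational := by
  refine ⟨1, 2 * (1 + X 0 ^ 2), fun x _ => ?_, fun x _ => ?_⟩
  · simp only [map_mul, map_add, map_one, map_pow, MvPolynomial.aeval_X, map_ofNat]
    positivity
  · simp only [arctanRep_integrand, map_mul, map_add, map_one, map_pow, MvPolynomial.aeval_X, map_ofNat]

/-- **The summit implies the crux** (`KontsevichZagierPeriods → GpcLegendreLemniscatic`): by
`exists_isRational_equivalent_holds`, soundness and the proved value identity, Conjecture 1 for
RATIONAL representations already forces `[r₀] ~ [r₀']`. So the crux cannot be refuted without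
refuting the Kontsevich–Zagier period conjecture as typed in the tree. [folklore] -/
theorem gpcLegendre_of_kontsevichZagierPeriods (h : KontsevichZagierPeriods) : GpcLegendreLemniscatic := by
  rw [gpcLegendre_iff]
  obtain ⟨m, r₁, hr₁, he⟩ := exists_isRational_equivalent_holds legendreRep
  have hv : r₁.value = arctanRep.value :=
    (Equivalent.value_eq_holds he).symm.trans legendreRep_value_eq_arctanRep_value
  have h' : Equivalent r₁ arctanRep := h r₁ arctanRep hr₁ arctanRep_isRational hv
  exact he.trans h'

/-- Contrapositive, the KILL CRITERION made formal: `¬ crux → ¬ summit`. [folklore] -/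
theorem not_kontsevichZagierPeriods_of_not_gpcLegendre (h : ¬ GpcLegendreLemniscatic) :
    ¬ KontsevichZagierPeriods :=
  fun hs => h (gpcLegendre_of_kontsevichZagierPeriods hs)

/-! ## §6 Chain audit (the planned positive chain, re-derived; information for provers)

Coordinates: `t` = crux variable, `x` = McKean–Moll variable, `t² = 2x²/(1+x²)` (`x ∈ (0,1) ↔ t ∈ (0,1)`,
`dt = √2 (1+x²)^{-3/2} dx`, `1 − t² = (1−x²)/(1+x²)`, `1 − t²/2 = 1/(1+x²)`):

* `k(t) dt = √2 dx/√(1−x⁴)`, `e(t) dt = √2 (1−x²) dx/(1−x⁴)^{3/2}`,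
  `g(t) dt = (2e − k) dt = √2 √(1−x²)/(1+x²)^{3/2} dx = √2 [x²/√(1−x⁴) + F′(x)] dx` with
  `F(x) = x√(1−x²)/√(1+x²)`, `F′ = (1 − 2x² − x⁴)/((1+x²)√(1−x⁴))`, `F(0) = F(1) = 0`, `F` continuous on
  `[0,1]`, semialgebraic (checked symbolically: `x² + (1−2x²−x⁴)/(1+x²) = (1−x²)/(1+x²)` ✓).
* M1 (rule 2, product map on `(0,1)²`, Jacobian `2(1+x₀²)^{-3/2}(1+x₁²)^{-3/2} > 0`):
  `r₀ ~ [(0,1)², 2(x₀²/√(1−x₀⁴) + F′(x₀))/√(1−x₁⁴)]`; integrable: `|F′| ≤ C/√(1−x)`.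
* M2 (rule 1b) split; M3 (rule 2, swap coordinates) + (rule 1a, null set `(0,1)×{0,1}`) + (rule 3,
  primitive `2F(t)/√(1−x⁴)` on the band `(0,1)×[0,1]`, base integrand `F(1) − F(0) = 0`) + (rule 1b,
  zero integrand): the `F′`-term is `≡ 0`. Remains `2·[(0,1)², x₀²/√((1−x₀⁴)(1−x₁⁴))]`, value `2AB = π/2`.
* M4 (rule 2, `(u,v) = (x₀⁴, x₁⁴)`): `~ 2·[(0,1)², (1/16) u^{-1/4}(1−u)^{-1/2} v^{-3/4}(1−v)^{-1/2}]`
  = `(1/8)[B(¾,½) ⊗ B(¼,½)]`; exponents `−1/4, −1/2, −3/4, −1/2 > −1` ✓ (product of two `L¹((0,1))`).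
* M5 (rule 2, Dirichlet `Φ(σ,ρ) = (ρσ, ρ(1−σ))`, `(0,1)² → {s,t>0, s+t<1}`, Jacobian `ρ`): with
  `(a,b,c) = (¼,½,½)`, `[ρ^{a+b−1}(1−ρ)^{c−1} σ^{a−1}(1−σ)^{b−1}] ~ [Δ, s^{a−1}t^{b−1}(1−s−t)^{c−1}]`;
  simplex integrand `s^{-3/4}t^{-1/2}(1−s−t)^{-1/2}`: integrable (corner strata `(1,0)`, `(0,1)`:
  `t^{-1/2}u^{-1/2}`, `s^{-3/4}u^{-1/2}` in local coordinates `u = 1−s−t`) ✓.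
* M6 (rule 2, `Ψ(s,τ) = (s,(1−s)τ)`, Jacobian `1−s`): `~ [(0,1)², s^{-3/4}·τ^{-1/2}(1−τ)^{-1/2}]`
  (`b + c − 1 = 0`) = `[B(¼,1) ⊗ B(½,½)]`.
* M7 (swap + rule 1a + rule 3, primitive `4s^{1/4}τ^{-1/2}(1−τ)^{-1/2}`, continuous on `s ∈ [0,1]`):
  `~ [(0,1), 4τ^{-1/2}(1−τ)^{-1/2}]` (value `4π`); with the factor `1/8` inside: `[(0,1), 1/(2√(τ(1−τ)))]`.
* M8 (rule 2, `τ = y²/(1+y²)`, `(0,∞) → (0,1)`): `~ [(0,∞), 1/(1+y²)]`; M9 (rules 1a, 1b, reflection):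
  `[ℝ, 1/(2(1+y²))] = [(−∞,0), ·] + [(0,∞), ·] = 2·[(0,∞), 1/(2(1+y²))] = [(0,∞), 1/(1+y²)]`.
  Integer bookkeeping only (`KZ.IntegralRep.of_constMul_nat_sub_nsmul_mem_relations`); the algebraic
  constants `√2`, `1/16`, `1/8` live inside integrands. No division by an integer is needed.
All maps are polynomial or `(·)^{1/4}`-algebraic, injective and differentiable on the open cells
(rule 2 as typed needs `HasFDerivWithinAt` at EVERY point of the domain — satisfied on open domains);
every rule-3 instance has `a ≤ b` constant (`0 ≤ 1`) and a closed-fibre-continuous semialgebraic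
primitive. Nothing here is an obstruction; it is the prover's checklist (≈ 12 moves, products via
`KZ.Equivalent.prod` / `of_mul_mem_relations`, reindexing via `of_sub_of_reindex_mem_relations`). -/

/-! ## §7 Certified first move of the SIMPLIFIED chain (positive content, evidence for provers)

Lawden's substitution `x = √(1 − t²)` (Ch. 3 Ex. 24 hint; tree lemmas `lemniscaticK_subst_sqrt`,
`lemniscaticE_subst_sqrt`) sends `k(x)dx ↦ √2 dt/√(1−t⁴)` and `g(x)dx = (2e − k)(x)dx ↦ √2 t² dt/√(1−t⁴)`
EXACTLY — no exact `F′`-term appears (contrast McKean–Moll's `t² = 2x²/(1+x²)`, §6). So the chain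
starts with ONE rule-(2) move in each factor (`Equivalent.prod` of the tree glues them):
`r₀ = [g]·[k] ~ [√2t²/√(1−t⁴)]·[√2/√(1−t⁴)]` (`equivalent_legendreRep_lemniscateRep`), and the crux is
EQUIVALENT to the purely lemniscatic statement `gpcLegendre_iff_lemniscate`. What remains for a prover:
`u = t⁴` in each factor (rule 2), Dirichlet's two polynomial substitutions (rule 2, dimension 2), ONE
Newton–Leibniz move (`∫₀¹ s^{-3/4} ds = 4`, the minimum allowed by §3), and the arctangent
bookkeeping — about seven moves. -/

/-- A ONE-DIMENSIONAL CHANGE OF VARIABLES between unit-interval representations is a rule-(2) move: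
`φ : (0,1) → (0,1)` semialgebraic, differentiable, injective and onto, `f = (g ∘ φ)·|φ′|`.
[cite: KontsevichZagier2001, §1.2 rule (2)] -/
theorem unitRep_sub_unitRep_mem_changeOfVariablesRel {φ φ' f g : ℝ → ℝ}
    (hφ : IsSemialgebraicFunOn ℚ unitIoo (fun x => φ (x 0)))
    (hderiv : ∀ t ∈ Ioo (0:ℝ) 1, HasDerivAt φ (φ' t) t) (hinj : InjOn φ (Ioo 0 1))
    (himage : φ '' Ioo 0 1 = Ioo 0 1)
    (hf : IsSemialgebraicFunOn ℚ unitIoo (fun x => f (x 0))) (hfi : IntegrableOn f (Ioo 0 1))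
    (hg : IsSemialgebraicFunOn ℚ unitIoo (fun x => g (x 0))) (hgi : IntegrableOn g (Ioo 0 1))
    (hfg : ∀ t ∈ Ioo (0:ℝ) 1, f t = g (φ t) * |φ' t|) :
    of (unitRep f hf hfi) - of (unitRep g hg hgi) ∈ changeOfVariablesRel := by
  refine ⟨1, unitRep f hf hfi, unitRep g hg hgi, fun x _ => φ (x 0),
    fun x => φ' (x 0) • ContinuousLinearMap.id ℝ (Fin 1 → ℝ), ?_, ?_, ?_, ?_, ?_, rfl⟩
  · exact IsSemialgebraicMapOn.of_forall isSemialgebraic_unitIoo fun _ => hφ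
  · intro x hx
    refine HasFDerivAt.hasFDerivWithinAt ?_
    refine hasFDerivAt_pi'' fun i => ?_
    have h1 : HasFDerivAt (fun y : Fin 1 → ℝ => φ (y 0))
        ((ContinuousLinearMap.smulRight (1 : ℝ →L[ℝ] ℝ) (φ' (x 0))).comp (ContinuousLinearMap.proj 0)) x :=
      HasFDerivAt.comp x (hderiv (x 0) hx).hasFDerivAt (hasFDerivAt_apply 0 x)
    refine h1.congr_fderiv (ContinuousLinearMap.ext fun v => ?_)
    simp [Fin.fin_one_eq_zero i, mul_comm]
  · intro x hx y hy hxy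
    have h0 : φ (x 0) = φ (y 0) := congrFun hxy 0
    have h1 : x 0 = y 0 := hinj hx hy h0
    funext i
    rw [Fin.fin_one_eq_zero i]
    exact h1
  · ext z
    constructor
    · intro hz
      have hz' : z 0 ∈ φ '' Ioo 0 1 := by rw [himage]; exact hz
      obtain ⟨t, ht, hzt⟩ := hz'
      refine ⟨fun _ => t, ht, ?_⟩
      funext i
      rw [Fin.fin_one_eq_zero i]
      exact hzt
    · rintro ⟨x, hx, rfl⟩
      show φ (x 0) ∈ Ioo (0:ℝ) 1
      rw [← himage]
      exact mem_image_of_mem φ hx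
  · intro x hx
    have hdet : (φ' (x 0) • ContinuousLinearMap.id ℝ (Fin 1 → ℝ)).det = φ' (x 0) := by
      simp [ContinuousLinearMap.det]
    show f (x 0) = g (φ (x 0)) * |(φ' (x 0) • ContinuousLinearMap.id ℝ (Fin 1 → ℝ)).det|
    rw [hdet]
    exact hfg (x 0) hx

/-- `√(1 − t²) ∈ (0,1)` for `t ∈ (0,1)`. [folklore] -/
theorem sqrt_one_sub_sq_mem_Ioo {t : ℝ} (ht : t ∈ Ioo (0:ℝ) 1) : Real.sqrt (1 - t ^ 2) ∈ Ioo (0:ℝ) 1 := by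
  refine ⟨Real.sqrt_pos.mpr (by nlinarith [ht.1, ht.2]), ?_⟩
  rw [Real.sqrt_lt' one_pos]
  nlinarith [ht.1, ht.2]

/-- `0 < 1 − t⁴` on `(0,1)`. [folklore] -/
theorem one_sub_pow_four_pos {t : ℝ} (ht : t ∈ Ioo (0:ℝ) 1) : 0 < 1 - t ^ 4 :=
  sub_pos.mpr (pow_lt_one₀ ht.1.le ht.2 four_ne_zero)

/-- `d/dt √(1 − t²) = −t/√(1 − t²)` on `(0,1)`. [folklore] -/
theorem hasDerivAt_sqrt_one_sub_sq {t : ℝ} (ht : t ∈ Ioo (0:ℝ) 1) :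
    HasDerivAt (fun t : ℝ => Real.sqrt (1 - t ^ 2)) (-(t / Real.sqrt (1 - t ^ 2))) t := by
  have h1 : HasDerivAt (fun t : ℝ => 1 - t ^ 2) (-(2 * t)) t := by
    simpa using (hasDerivAt_pow 2 t).const_sub 1
  have h2 := h1.sqrt (by nlinarith [ht.1, ht.2] : (1:ℝ) - t ^ 2 ≠ 0)
  convert h2 using 1
  field_simp

/-- `t ↦ √(1 − t²)` is injective on `(0,1)`. [folklore] -/
theorem injOn_sqrt_one_sub_sq : InjOn (fun t : ℝ => Real.sqrt (1 - t ^ 2)) (Ioo 0 1) := by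
  intro a ha b hb hab
  have ha' : 0 ≤ 1 - a ^ 2 := by nlinarith [ha.1, ha.2]
  have hb' : 0 ≤ 1 - b ^ 2 := by nlinarith [hb.1, hb.2]
  have h2 : Real.sqrt (1 - a ^ 2) ^ 2 = Real.sqrt (1 - b ^ 2) ^ 2 := by
    simp only at hab
    rw [hab]
  rw [Real.sq_sqrt ha', Real.sq_sqrt hb'] at h2
  have h3 : a ^ 2 = b ^ 2 := by linarith
  exact (pow_left_inj₀ ha.1.le hb.1.le two_ne_zero).mp h3

/-- `t ↦ √(1 − t²)` maps `(0,1)` onto `(0,1)`. [folklore] -/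
theorem image_sqrt_one_sub_sq : (fun t : ℝ => Real.sqrt (1 - t ^ 2)) '' Ioo (0:ℝ) 1 = Ioo 0 1 := by
  ext x
  constructor
  · rintro ⟨t, ht, rfl⟩
    exact sqrt_one_sub_sq_mem_Ioo ht
  · intro hx
    refine ⟨Real.sqrt (1 - x ^ 2), sqrt_one_sub_sq_mem_Ioo hx, ?_⟩
    simp only
    rw [Real.sq_sqrt (by nlinarith [hx.1, hx.2]), sub_sub_cancel, Real.sqrt_sq hx.1.le]

/-- `|−t/√(1−t²)| = t/√(1−t²)` on `(0,1)`. [folklore] -/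
theorem abs_deriv_sqrt_one_sub_sq {t : ℝ} (ht : t ∈ Ioo (0:ℝ) 1) :
    |(-(t / Real.sqrt (1 - t ^ 2)))| = t / Real.sqrt (1 - t ^ 2) := by
  rw [abs_neg, abs_of_pos (div_pos ht.1 (Real.sqrt_pos.mpr (by nlinarith [ht.1, ht.2])))]

/-- `√2` is algebraic. [folklore] -/
theorem isAlgebraic_sqrt_two : IsAlgebraic ℚ (Real.sqrt 2) := by
  refine ⟨Polynomial.X ^ 2 - Polynomial.C 2, Polynomial.X_pow_sub_C_ne_zero two_pos 2, ?_⟩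
  simp [Real.sq_sqrt (by norm_num : (0:ℝ) ≤ 2)]

/-- `ã(t) = √2/√(1 − t⁴)`, the lemniscatic `A`-integrand (`∫₀¹ ã = K(1/√2)`). [cite: Lawden1989, §4.3 eqs. (4.3.2)–(4.3.6)] -/
def aTilde (t : ℝ) : ℝ := Real.sqrt 2 / Real.sqrt (1 - t ^ 4)

/-- `s̃(t) = √2 t²/√(1 − t⁴)`, the lemniscatic `B`-integrand (`∫₀¹ s̃ = 2E(1/√2) − K(1/√2)`). [folklore] -/
def sTilde (t : ℝ) : ℝ := Real.sqrt 2 * t ^ 2 / Real.sqrt (1 - t ^ 4)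

/-- `x ↦ 1 − x₀⁴` is semialgebraic on `unitIoo`. [folklore] -/
theorem isSemialgebraicFunOn_one_sub_pow_four :
    IsSemialgebraicFunOn ℚ unitIoo (fun x => 1 - x 0 ^ 4) := by
  have := isSemialgebraicFunOn_aeval isSemialgebraic_unitIoo (1 - X 0 ^ 4 : MvPolynomial (Fin 1) ℚ)
  refine this.congr fun x _ => ?_
  simp

/-- `x ↦ ã(x₀)` is semialgebraic on `unitIoo`. [folklore] -/
theorem isSemialgebraicFunOn_aTilde : IsSemialgebraicFunOn ℚ unitIoo (fun x => aTilde (x 0)) := by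
  have hc := isSemialgebraicFunOn_const_of_isAlgebraic isSemialgebraic_unitIoo isAlgebraic_sqrt_two
  have hd := IsSemialgebraicFunOn.sqrt_holds isSemialgebraicFunOn_one_sub_pow_four
  refine ((hc.div hd) fun x hx => ?_).congr fun x _ => ?_
  · exact (Real.sqrt_pos.2 (one_sub_pow_four_pos hx)).ne'
  · simp [aTilde]

/-- `x ↦ s̃(x₀)` is semialgebraic on `unitIoo`. [folklore] -/
theorem isSemialgebraicFunOn_sTilde : IsSemialgebraicFunOn ℚ unitIoo (fun x => sTilde (x 0)) := by
  have hc := isSemialgebraicFunOn_const_of_isAlgebraic isSemialgebraic_unitIoo isAlgebraic_sqrt_two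
  have hsq : IsSemialgebraicFunOn ℚ unitIoo (fun x => x 0 ^ 2) := by
    have := isSemialgebraicFunOn_aeval isSemialgebraic_unitIoo (X 0 ^ 2 : MvPolynomial (Fin 1) ℚ)
    exact this.congr fun x _ => by simp
  have hn := IsSemialgebraicFunOn.mul_holds hc hsq
  have hd := IsSemialgebraicFunOn.sqrt_holds isSemialgebraicFunOn_one_sub_pow_four
  refine ((hn.div hd) fun x hx => ?_).congr fun x _ => ?_
  · exact (Real.sqrt_pos.2 (one_sub_pow_four_pos hx)).ne'
  · simp [sTilde]

/-- Domination `√(1 − t²) ≤ √(1 − t⁴)` on `(0,1)`. [folklore] -/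
theorem sqrt_one_sub_sq_le_sqrt_one_sub_pow_four {t : ℝ} (ht : t ∈ Ioo (0:ℝ) 1) :
    Real.sqrt (1 - t ^ 2) ≤ Real.sqrt (1 - t ^ 4) := by
  apply Real.sqrt_le_sqrt
  have h2 : t ^ 2 ≤ 1 := by nlinarith [ht.1, ht.2]
  nlinarith [mul_le_mul_of_nonneg_left h2 (sq_nonneg t)]

/-- `ã` and `s̃` are integrable on `(0,1)` (both `≤ √2/√(1 − t²)`). [folklore] -/
theorem integrableOn_aTilde_sTilde :
    IntegrableOn aTilde (Ioo 0 1) ∧ IntegrableOn sTilde (Ioo 0 1) := by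
  have hdom : IntegrableOn (fun t => Real.sqrt 2 * aFun t) (Ioo 0 1) := integrableOn_aFun.const_mul _
  have hbound : ∀ t ∈ Ioo (0:ℝ) 1, ∀ c : ℝ, 0 ≤ c → c ≤ 1 →
      ‖Real.sqrt 2 * c / Real.sqrt (1 - t ^ 4)‖ ≤ Real.sqrt 2 * aFun t := by
    intro t ht c hc0 hc1
    have h1 : 0 < Real.sqrt (1 - t ^ 2) := Real.sqrt_pos.2 (by nlinarith [ht.1, ht.2])
    have h2 : 0 < Real.sqrt (1 - t ^ 4) := Real.sqrt_pos.2 (one_sub_pow_four_pos ht)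
    rw [Real.norm_eq_abs, abs_of_nonneg (by positivity), aFun, mul_one_div]
    calc Real.sqrt 2 * c / Real.sqrt (1 - t ^ 4) ≤ Real.sqrt 2 / Real.sqrt (1 - t ^ 4) := by
          apply div_le_div_of_nonneg_right _ h2.le
          nlinarith [Real.sqrt_nonneg 2]
      _ ≤ Real.sqrt 2 / Real.sqrt (1 - t ^ 2) :=
          div_le_div_of_nonneg_left (Real.sqrt_nonneg 2) h1 (sqrt_one_sub_sq_le_sqrt_one_sub_pow_four ht)
  have hmeasA : AEStronglyMeasurable aTilde (volume.restrict (Ioo (0:ℝ) 1)) := by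
    refine ContinuousOn.aestronglyMeasurable ?_ measurableSet_Ioo
    unfold aTilde
    refine ContinuousOn.div (by fun_prop) (by fun_prop) fun t ht => ?_
    exact (Real.sqrt_pos.2 (one_sub_pow_four_pos ht)).ne'
  have hmeasS : AEStronglyMeasurable sTilde (volume.restrict (Ioo (0:ℝ) 1)) := by
    refine ContinuousOn.aestronglyMeasurable ?_ measurableSet_Ioo
    unfold sTilde
    refine ContinuousOn.div (by fun_prop) (by fun_prop) fun t ht => ?_
    exact (Real.sqrt_pos.2 (one_sub_pow_four_pos ht)).ne'
  constructor
  · refine hdom.mono' hmeasA ?_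
    refine (ae_restrict_mem measurableSet_Ioo).mono fun t ht => ?_
    have := hbound t ht 1 zero_le_one le_rfl
    rw [mul_one] at this
    exact this
  · refine hdom.mono' hmeasS ?_
    refine (ae_restrict_mem measurableSet_Ioo).mono fun t ht => ?_
    exact hbound t ht (t ^ 2) (sq_nonneg t) (by nlinarith [ht.1, ht.2])

/-- `[(0,1), ã]`, value `K(1/√2)` (the lemniscatic `√2·∫dt/√(1−t⁴)`). [folklore] -/
def aTildeRep : IntegralRep 1 := unitRep aTilde isSemialgebraicFunOn_aTilde integrableOn_aTilde_sTilde.1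

/-- `[(0,1), s̃]`, value `2E − K`. [folklore] -/
def sTildeRep : IntegralRep 1 := unitRep sTilde isSemialgebraicFunOn_sTilde integrableOn_aTilde_sTilde.2

/-- After `x = √(1 − t²)`, `g(x)dx` becomes `√2 t² dt/√(1 − t⁴)` EXACTLY (from the tree's two
substitution identities and `g = 2e − k`). [cite: Lawden1989, Ch. 3 Exercise 24 (hint)] -/
theorem gFun_subst_sqrt {t : ℝ} (ht : t ∈ Ioo (0:ℝ) 1) :
    t / Real.sqrt (1 - t ^ 2) * gFun (Real.sqrt (1 - t ^ 2)) = sTilde t := by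
  have hK := Literature.Analysis.SpecialFunctions.lemniscaticK_subst_sqrt ht
  have hE := Literature.Analysis.SpecialFunctions.lemniscaticE_subst_sqrt ht
  rw [gFun_eq (sqrt_one_sub_sq_mem_Ioo ht)]
  unfold eFun kFun
  unfold sTilde
  have hs : 0 < Real.sqrt (1 - t ^ 4) := Real.sqrt_pos.2 (one_sub_pow_four_pos ht)
  have hr : 0 < Real.sqrt 2 := Real.sqrt_pos.2 two_pos
  have hr2 : Real.sqrt 2 ^ 2 = 2 := Real.sq_sqrt two_pos.le
  calc t / Real.sqrt (1 - t ^ 2) *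
        (2 * (Real.sqrt (1 - Real.sqrt (1 - t ^ 2) ^ 2 / 2) / Real.sqrt (1 - Real.sqrt (1 - t ^ 2) ^ 2)) -
          1 / Real.sqrt ((1 - Real.sqrt (1 - t ^ 2) ^ 2) * (1 - Real.sqrt (1 - t ^ 2) ^ 2 / 2)))
        = 2 * (t / Real.sqrt (1 - t ^ 2) *
            (Real.sqrt (1 - Real.sqrt (1 - t ^ 2) ^ 2 / 2) / Real.sqrt (1 - Real.sqrt (1 - t ^ 2) ^ 2))) -
          t / Real.sqrt (1 - t ^ 2) *
            (1 / Real.sqrt ((1 - Real.sqrt (1 - t ^ 2) ^ 2) * (1 - Real.sqrt (1 - t ^ 2) ^ 2 / 2))) := by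
          ring
    _ = 2 * ((1 + t ^ 2) / (Real.sqrt 2 * Real.sqrt (1 - t ^ 4))) - Real.sqrt 2 / Real.sqrt (1 - t ^ 4) := by
          rw [hE, hK]
    _ = Real.sqrt 2 * t ^ 2 / Real.sqrt (1 - t ^ 4) := by
          field_simp
          linear_combination (-(1 + t ^ 2)) * hr2

/-- After `x = √(1 − t²)`, `k(x)dx` becomes `√2 dt/√(1 − t⁴)`. [cite: Lawden1989, §4.3 eqs. (4.3.2)–(4.3.6)] -/
theorem kFun_subst_sqrt {t : ℝ} (ht : t ∈ Ioo (0:ℝ) 1) :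
    t / Real.sqrt (1 - t ^ 2) * kFun (Real.sqrt (1 - t ^ 2)) = aTilde t :=
  Literature.Analysis.SpecialFunctions.lemniscaticK_subst_sqrt ht

/-- **Move 1 on the `k`-factor**: `[(0,1), ã] − [(0,1), k]` is ONE rule-(2) move (`x = √(1−t²)`). [cite: KontsevichZagier2001, §1.2 rule (2)] -/
theorem aTildeRep_sub_kRep_mem_changeOfVariablesRel : of aTildeRep - of kRep ∈ changeOfVariablesRel := by
  refine unitRep_sub_unitRep_mem_changeOfVariablesRel (φ := fun t => Real.sqrt (1 - t ^ 2))
    (φ' := fun t => -(t / Real.sqrt (1 - t ^ 2)))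
    (IsSemialgebraicFunOn.sqrt_holds isSemialgebraicFunOn_one_sub_sq)
    (fun t ht => hasDerivAt_sqrt_one_sub_sq ht) injOn_sqrt_one_sub_sq image_sqrt_one_sub_sq
    _ _ _ _ fun t ht => ?_
  rw [abs_deriv_sqrt_one_sub_sq ht, mul_comm, kFun_subst_sqrt ht]

/-- **Move 1 on the `g`-factor**: `[(0,1), s̃] − [(0,1), g]` is ONE rule-(2) move (`x = √(1−t²)`). [cite: KontsevichZagier2001, §1.2 rule (2)] -/
theorem sTildeRep_sub_gRep_mem_changeOfVariablesRel : of sTildeRep - of gRep ∈ changeOfVariablesRel := by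
  refine unitRep_sub_unitRep_mem_changeOfVariablesRel (φ := fun t => Real.sqrt (1 - t ^ 2))
    (φ' := fun t => -(t / Real.sqrt (1 - t ^ 2)))
    (IsSemialgebraicFunOn.sqrt_holds isSemialgebraicFunOn_one_sub_sq)
    (fun t ht => hasDerivAt_sqrt_one_sub_sq ht) injOn_sqrt_one_sub_sq image_sqrt_one_sub_sq
    _ _ _ _ fun t ht => ?_
  rw [abs_deriv_sqrt_one_sub_sq ht, mul_comm, gFun_subst_sqrt ht]

/-- **The lemniscatic product representation** `[s̃]·[ã] = [(0,1)², 2t₀²/(√(1−t₀⁴)√(1−t₁⁴))]`. [folklore] -/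
def lemniscateRep : IntegralRep 2 := sTildeRep.prod aTildeRep

/-- **`r₀ ~ [s̃]·[ã]` by two rule-(2) moves** (glued by the tree's `Equivalent.prod`, i.e. the proved
left/right ideal property of `KZ.relations`). [folklore] -/
theorem equivalent_legendreRep_lemniscateRep : Equivalent legendreRep lemniscateRep := by
  have hg : Equivalent sTildeRep gRep :=
    changeOfVariablesRel_subset_relations sTildeRep_sub_gRep_mem_changeOfVariablesRel
  have hk : Equivalent aTildeRep kRep :=
    changeOfVariablesRel_subset_relations aTildeRep_sub_kRep_mem_changeOfVariablesRel
  exact Equivalent.prod hg.symm hk.symm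

/-- The domain of `[s̃]·[ã]` is `(0,1)²`. [folklore] -/
theorem lemniscateRep_domain : lemniscateRep.domain = unitSq := prod_unitRep_domain _ _ _ _ _ _

/-- The integrand of `[s̃]·[ã]` is `s̃(t₀)·ã(t₁) = 2t₀²/(√(1−t₀⁴)√(1−t₁⁴))`. [folklore] -/
theorem lemniscateRep_integrand_apply (x : Fin 2 → ℝ) :
    lemniscateRep.integrand x = 2 * x 0 ^ 2 / (Real.sqrt (1 - x 0 ^ 4) * Real.sqrt (1 - x 1 ^ 4)) := by
  rw [show lemniscateRep = sTildeRep.prod aTildeRep from rfl, sTildeRep, aTildeRep, prod_unitRep_integrand_apply]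
  unfold sTilde aTilde
  have hr2 : Real.sqrt 2 * Real.sqrt 2 = 2 := Real.mul_self_sqrt two_pos.le
  rw [div_mul_div_comm, show Real.sqrt 2 * x 0 ^ 2 * Real.sqrt 2 = 2 * x 0 ^ 2 by linear_combination x 0 ^ 2 * hr2]

/-- **Value**: `∫₀¹ √2t²/√(1−t⁴) · ∫₀¹ √2/√(1−t⁴) = π/2` — Euler's 1738 identity
`∫₀¹dt/√(1−t⁴)·∫₀¹t²dt/√(1−t⁴) = π/4`, here obtained from Legendre's relation by the SOUNDNESS of two
moves. [cite: Lawden1989, §4.3 eqs. (4.3.2)–(4.3.6)] -/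
theorem lemniscateRep_value : lemniscateRep.value = Real.pi / 2 :=
  (Equivalent.value_eq_holds equivalent_legendreRep_lemniscateRep).symm.trans legendreRep_value

/-- **The crux in lemniscatic form**: `GpcLegendreLemniscatic ↔ [s̃]·[ã] ~ [ℝ, 1/(2(1+x²))]` — what
remains is `u = t⁴`, Dirichlet's two substitutions, one Newton–Leibniz move and the arctangent. [folklore] -/
theorem gpcLegendre_iff_lemniscate : GpcLegendreLemniscatic ↔ Equivalent lemniscateRep arctanRep := by
  rw [gpcLegendre_iff]
  exact ⟨fun h => equivalent_legendreRep_lemniscateRep.symm.trans h,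
    fun h => equivalent_legendreRep_lemniscateRep.trans h⟩

/-! ## §8 Additivity is necessary — modulo van den Dries Ch. 4 (2.4) — via the o-minimal Euler characteristic of the domain

The tree has van den Dries's Euler characteristic `eulerChar` with (2.1)–(2.11) (cells, additivity, the
fibre formula) and `real_isOMinimal_holds`; it lacks (2.4) (invariance under injective definable
maps; needs the transposition proposition (2.13)), vendored by this seat as the named fact
`Literature.ModelTheory.ExponentialFields.Dries1998_ch4_prop_2_4` (proposal pending; local copy
below). RESULTS: `domainEuler : FormalRep →+ ℤ`, `[r] ↦ E(r.domain)`, kills every Newton–Leibniz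
move UNCONDITIONALLY (`domainEuler_eq_zero_of_mem_newtonLeibnizRel`: a band with closed bounded
fibres has `E = E(base)`) and every change-of-variables move modulo (2.4); `E((0,1)²) = 1`,
`E(ℝ) = −1`, so `domainEuler([r₀] − [r₀']) = 2 ≠ 0`: `legendre_not_mem_closure_without_additivity`
(modulo (2.4)) and `legendre_not_mem_closure_newtonLeibniz` (unconditional). With §3: every
derivation of the crux uses rule (1) AND rule (3). `domainEuler` is the third subcalculus invariant
of the summit (after `KZ.coeffSum` and `KZ.restrictedEval`), the only one that sees 2-term elements
of `closure(rules 2, 3)`. -/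

/-- The o-minimal Euler characteristic of `S ⊆ ℝⁿ` in the ordered field `ℝ` (van den Dries's
`E(S)`; tree `eulerChar`). [cite: Dries1998, Ch. 4 (2.3)] -/
def realEuler (n : ℕ) (S : Set (Fin n → ℝ)) : ℤ := eulerChar Language.orderedRing n S

/-- `ℝ` is o-minimal (tree theorem `real_isOMinimal_holds`). [cite: Dries1998, Ch. 2 (2.11)] -/
theorem isOMinimal_real : Language.orderedRing.IsOMinimal ℝ := real_isOMinimal_holds

/-- `ℚ`-semialgebraic sets are definable in the ordered field `ℝ`. [cite: BasuPollackRoy2006, §2.5.1 (proof of Thm. 2.77)] -/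
theorem definable_univ_of_isSemialgebraic {n : ℕ} {s : Set (Fin n → ℝ)} (hs : IsSemialgebraic ℚ s) :
    (univ : Set ℝ).Definable Language.orderedRing s :=
  (definable_of_isSemialgebraic hs).mono (subset_univ _)

/-- `<` is definable. [folklore] -/
theorem definable_lt_real : (univ : Set ℝ).Definable Language.orderedRing {v : Fin 2 → ℝ | v 0 < v 1} := by
  have h := Literature.ModelTheory.ExponentialFields.isSemialgebraic_setOf_eval_pos (k := ℚ) (R := ℝ)
    (X 1 - X 0 : MvPolynomial (Fin 2) ℚ)
  have heq : {x : Fin 2 → ℝ | 0 < aeval x (X 1 - X 0 : MvPolynomial (Fin 2) ℚ)} = {v | v 0 < v 1} := by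
    ext v
    simp [sub_pos]
  rw [heq] at h
  exact definable_univ_of_isSemialgebraic h

/-- `E` of a point of `ℝ¹` is `1`. [cite: Dries1998, Ch. 4 (2.1)] -/
theorem realEuler_point (c : ℝ) : realEuler 1 {y : Fin 1 → ℝ | y 0 = c} = 1 := by
  have hset : {y : Fin 1 → ℝ | y 0 = c} = {fun _ => c} := by
    ext y
    simp only [mem_setOf_eq, mem_singleton_iff]
    constructor
    · intro h
      funext i
      rw [Fin.fin_one_eq_zero i]
      exact h
    · intro h
      rw [h]
  rw [realEuler, hset, eulerChar_eq_ncard_of_finite isOMinimal_real definable_lt_real (Set.finite_singleton _), Set.ncard_singleton]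
  rfl

/-- `E` of an open interval of `ℝ¹` is `−1`. [cite: Dries1998, Ch. 4 (2.1)] -/
theorem realEuler_Ioo {a b : ℝ} (hab : a < b) :
    realEuler 1 {y : Fin 1 → ℝ | a < y 0 ∧ y 0 < b} = -1 := by
  have hcell := isCell_box (L := Language.orderedRing) (M := ℝ) definable_lt_real (fun _ : Fin 1 => a) (fun _ => b)
    (fun _ => hab)
  have hset : {v : Fin 1 → ℝ | ∀ i, (fun _ : Fin 1 => a) i < v i ∧ v i < (fun _ : Fin 1 => b) i} =
      {y : Fin 1 → ℝ | a < y 0 ∧ y 0 < b} := by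
    ext v
    simp [Fin.forall_fin_one]
  rw [hset] at hcell
  rw [realEuler, eulerChar_cell isOMinimal_real definable_lt_real hcell, dim_eq_typeDim isOMinimal_real definable_lt_real hcell, typeDim_const_true]
  norm_num

/-- `E` of the whole line `ℝ¹` is `−1`. [cite: Dries1998, Ch. 4 (2.1)] -/
theorem realEuler_univ_one : realEuler 1 (univ : Set (Fin 1 → ℝ)) = -1 := by
  have h0 : IsCell Language.orderedRing 0 (fun _ : Fin 0 => true) (univ : Set (Fin 0 → ℝ)) :=
    isCell_zero_iff.mpr rfl
  have hband := h0.band (f := none) (g := none) (by simp) (by simp) (by simp)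
  have hset : {v : Fin (0 + 1) → ℝ | (Fin.init v : Fin 0 → ℝ) ∈ (univ : Set (Fin 0 → ℝ)) ∧
      (∀ f' ∈ (none : Option ((Fin 0 → ℝ) → ℝ)), f' (Fin.init v) < v (Fin.last 0)) ∧
      ∀ g' ∈ (none : Option ((Fin 0 → ℝ) → ℝ)), v (Fin.last 0) < g' (Fin.init v)} = univ := by
    ext v
    simp
  rw [hset] at hband
  have hι : (Fin.snoc (fun _ : Fin 0 => true) true : Fin (0 + 1) → Bool) = fun _ => true := by
    funext i
    rw [Fin.fin_one_eq_zero i]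
    rfl
  rw [hι] at hband
  rw [realEuler, eulerChar_cell isOMinimal_real definable_lt_real hband, dim_eq_typeDim isOMinimal_real definable_lt_real hband, typeDim_const_true]
  norm_num

/-- `E` of a closed bounded interval `[a, b]` of `ℝ¹` (`a ≤ b`) is `1`. [cite: Dries1998, Ch. 4 (2.9)] -/
theorem realEuler_Icc {a b : ℝ} (hab : a ≤ b) :
    realEuler 1 {y : Fin 1 → ℝ | a ≤ y 0 ∧ y 0 ≤ b} = 1 := by
  rcases hab.eq_or_lt with rfl | hlt'
  · have hset : {y : Fin 1 → ℝ | a ≤ y 0 ∧ y 0 ≤ a} = {y | y 0 = a} := by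
      ext y
      simp only [mem_setOf_eq]
      constructor
      · intro h; exact le_antisymm h.2 h.1
      · intro h; exact ⟨h.ge, h.le⟩
    rw [hset]
    exact realEuler_point a
  · set P₁ : Set (Fin 1 → ℝ) := {y | y 0 = a} with hP₁
    set I : Set (Fin 1 → ℝ) := {y | a < y 0 ∧ y 0 < b} with hI
    set P₂ : Set (Fin 1 → ℝ) := {y | y 0 = b} with hP₂
    have hset : {y : Fin 1 → ℝ | a ≤ y 0 ∧ y 0 ≤ b} = (P₁ ∪ I) ∪ P₂ := by
      ext y
      simp only [mem_setOf_eq, mem_union, hP₁, hI, hP₂]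
      constructor
      · intro h
        rcases h.1.eq_or_lt with h1 | h1
        · exact Or.inl (Or.inl h1.symm)
        · rcases h.2.eq_or_lt with h2 | h2
          · exact Or.inr h2
          · exact Or.inl (Or.inr ⟨h1, h2⟩)
      · rintro ((h | h) | h)
        · exact ⟨h.symm.le, h ▸ hlt'.le⟩
        · exact ⟨h.1.le, h.2.le⟩
        · exact ⟨h ▸ hlt'.le, h.le⟩
    have hP₁fin : P₁.Finite := by
      have : P₁ = {fun _ => a} := by
        ext y; simp only [hP₁, mem_setOf_eq, mem_singleton_iff]
        constructor
        · intro h; funext i; rw [Fin.fin_one_eq_zero i]; exact h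
        · intro h; rw [h]
      rw [this]; exact Set.finite_singleton _
    have hP₂fin : P₂.Finite := by
      have : P₂ = {fun _ => b} := by
        ext y; simp only [hP₂, mem_setOf_eq, mem_singleton_iff]
        constructor
        · intro h; funext i; rw [Fin.fin_one_eq_zero i]; exact h
        · intro h; rw [h]
      rw [this]; exact Set.finite_singleton _
    have hP₁def : (univ : Set ℝ).Definable Language.orderedRing P₁ := definable_of_finite hP₁fin
    have hP₂def : (univ : Set ℝ).Definable Language.orderedRing P₂ := definable_of_finite hP₂fin
    have hIcell := isCell_box (L := Language.orderedRing) (M := ℝ) definable_lt_real (fun _ : Fin 1 => a) (fun _ => b)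
      (fun _ => hlt')
    have hIset : {v : Fin 1 → ℝ | ∀ i, (fun _ : Fin 1 => a) i < v i ∧ v i < (fun _ : Fin 1 => b) i} = I := by
      ext v
      simp [hI, Fin.forall_fin_one]
    rw [hIset] at hIcell
    have hIdef : (univ : Set ℝ).Definable Language.orderedRing I := hIcell.definable definable_lt_real
    have hd1 : Disjoint P₁ I := Set.disjoint_left.mpr fun y hy hyI => by
      simp only [hP₁, mem_setOf_eq] at hy
      simp only [hI, mem_setOf_eq] at hyI
      linarith [hyI.1]
    have hd2 : Disjoint (P₁ ∪ I) P₂ := Set.disjoint_left.mpr fun y hy hyP => by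
      simp only [hP₂, mem_setOf_eq] at hyP
      rcases hy with hy | hy
      · simp only [hP₁, mem_setOf_eq] at hy; linarith
      · simp only [hI, mem_setOf_eq] at hy; linarith [hy.2]
    rw [hset, realEuler, eulerChar_union isOMinimal_real definable_lt_real (hP₁def.union hIdef) hP₂def hd2,
      eulerChar_union isOMinimal_real definable_lt_real hP₁def hIdef hd1]
    have e1 := realEuler_point a
    have e2 := realEuler_Ioo hlt'
    have e3 := realEuler_point b
    simp only [realEuler] at e1 e2 e3
    rw [e1, e2, e3]
    norm_num

/-- `E((0,1)) = −1` for the unit interval of `ℝ¹`. [cite: Dries1998, Ch. 4 (2.1)] -/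
theorem realEuler_unitIoo : realEuler 1 unitIoo = -1 :=
  realEuler_Ioo zero_lt_one

/-- **`E((0,1)²) = 1`** (`E(A × B) = E(A)E(B)`, tree `eulerChar_prod`). [cite: Dries1998, Ch. 4 (2.11)] -/
theorem realEuler_legendreRep_domain : realEuler 2 legendreRep.domain = 1 := by
  have hA := definable_univ_of_isSemialgebraic isSemialgebraic_unitIoo
  have h := eulerChar_prod isOMinimal_real definable_lt_real (m := 1) (n := 1) hA hA
  have hu := realEuler_unitIoo
  simp only [realEuler] at hu
  rw [hu] at h
  change eulerChar Language.orderedRing (1 + 1) (IntegralRep.prodDomain gRep kRep) = 1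
  rw [show IntegralRep.prodDomain gRep kRep =
      {v : Fin (1 + 1) → ℝ | (fun i => v (Fin.castAdd 1 i)) ∈ unitIoo ∧ (fun j => v (Fin.natAdd 1 j)) ∈ unitIoo}
      from rfl, h]
  norm_num

/-- **`E(ℝ) = −1`** for the domain of `r₀'`. [cite: Dries1998, Ch. 4 (2.1)] -/
theorem realEuler_arctanRep_domain : realEuler 1 arctanRep.domain = -1 := realEuler_univ_one

/-- The additive extension `[r] ↦ E(r.domain)` to formal combinations. [folklore] -/
def domainEuler : FormalRep →+ ℤ := FreeAbelianGroup.lift fun p => realEuler p.1 p.2.domain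

/-- `domainEuler` of a generator. [folklore] -/
@[simp] theorem domainEuler_of {n : ℕ} (r : IntegralRep n) : domainEuler (of r) = realEuler n r.domain :=
  FreeAbelianGroup.lift_apply_of _ _

/-- `Fin.init (Fin.append x y) = x` for `y : Fin 1 → ℝ`. [folklore] -/
theorem init_append_one {n : ℕ} (x : Fin n → ℝ) (y : Fin 1 → ℝ) :
    Fin.init (Fin.append x y : Fin (n + 1) → ℝ) = x := by
  funext i
  exact Fin.append_left x y i

/-- `(Fin.append x y) (Fin.last n) = y 0` for `y : Fin 1 → ℝ`. [folklore] -/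
theorem append_last_one {n : ℕ} (x : Fin n → ℝ) (y : Fin 1 → ℝ) :
    (Fin.append x y : Fin (n + 1) → ℝ) (Fin.last n) = y 0 := by
  rw [show Fin.last n = Fin.natAdd n (0 : Fin 1) from Fin.ext (by simp)]
  exact Fin.append_right x y 0

/-- **A Newton–Leibniz move preserves `E` of the domain** (unconditionally): the band over `τ`
with closed bounded fibres `[a x, b x]` has `E = E(τ) · 1` by the fibre formula (tree
`eulerChar_eq_eulerChar_proj_mul`). [cite: Dries1998, Ch. 4 (2.11)] -/
theorem domainEuler_eq_zero_of_mem_newtonLeibnizRel {c : FormalRep} (hc : c ∈ newtonLeibnizRel) :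
    domainEuler c = 0 := by
  obtain ⟨n, r, r', a, b, F, -, -, -, hab, hdom, -, -, -, rfl⟩ := hc
  rw [map_sub, domainEuler_of, domainEuler_of, sub_eq_zero, realEuler, realEuler]
  have hS : (univ : Set ℝ).Definable Language.orderedRing r.domain :=
    definable_univ_of_isSemialgebraic r.isSemialgebraic_domain
  have hfib : ∀ x : Fin n → ℝ, {y : Fin 1 → ℝ | Fin.append x y ∈ r.domain} =
      {y | x ∈ r'.domain ∧ a x ≤ y 0 ∧ y 0 ≤ b x} := by
    intro x
    ext y
    rw [mem_setOf_eq, hdom, mem_setOf_eq, init_append_one, append_last_one]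
    rfl
  have hproj : {x : Fin n → ℝ | ∃ y : Fin 1 → ℝ, Fin.append x y ∈ r.domain} = r'.domain := by
    ext x
    simp only [mem_setOf_eq]
    constructor
    · rintro ⟨y, hy⟩
      have h : y ∈ {y : Fin 1 → ℝ | Fin.append x y ∈ r.domain} := hy
      rw [hfib x] at h
      exact h.1
    · intro hx
      refine ⟨fun _ => a x, ?_⟩
      have h : (fun _ : Fin 1 => a x) ∈ {y : Fin 1 → ℝ | Fin.append x y ∈ r.domain} := by
        rw [hfib x]
        exact ⟨hx, le_rfl, hab x hx⟩
      exact h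
  rw [eulerChar_eq_eulerChar_proj_mul isOMinimal_real definable_lt_real hS (e := 1) fun x ⟨y, hy⟩ => ?_, hproj, mul_one]
  have hx : x ∈ r'.domain := by
    have h : y ∈ {y : Fin 1 → ℝ | Fin.append x y ∈ r.domain} := hy
    rw [hfib x] at h
    exact h.1
  rw [hfib x]
  have hset : {y : Fin 1 → ℝ | x ∈ r'.domain ∧ a x ≤ y 0 ∧ y 0 ≤ b x} = {y | a x ≤ y 0 ∧ y 0 ≤ b x} := by
    ext y
    simp only [mem_setOf_eq]
    exact ⟨fun h => h.2, fun h => ⟨hx, h⟩⟩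
  rw [hset]
  exact realEuler_Icc (hab x hx)

/-- Local copy (test only) of the named fact `Literature.ModelTheory.ExponentialFields.Dries1998_ch4_prop_2_4`
(van den Dries 1998, Ch. 4, (2.4): `E` is invariant under injective definable maps), to be replaced
by the import once that Literature file lands. [cite: Dries1998, Ch. 4 (2.4)] -/
def Dries1998_ch4_prop_2_4 (L : FirstOrder.Language) (M : Type*) [L.Structure M]
    [LinearOrder M] [TopologicalSpace M] : Prop :=
  L.IsOMinimal M → (univ : Set M).Definable L {v : Fin 2 → M | v 0 < v 1} →
    ∀ {m n : ℕ} (S : Set (Fin m → M)) (f : (Fin m → M) → (Fin n → M)),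
      (univ : Set M).Definable L {z : Fin (m + n) → M | ∃ x ∈ S, z = Fin.append x (f x)} →
      Set.InjOn f S → eulerChar L n (f '' S) = eulerChar L m S

/-- **A change-of-variables move preserves `E` of the domain**, modulo (2.4). [cite: Dries1998, Ch. 4 (2.4)] -/
theorem domainEuler_eq_zero_of_mem_changeOfVariablesRel
    (hE : Dries1998_ch4_prop_2_4 Language.orderedRing ℝ) {c : FormalRep}
    (hc : c ∈ changeOfVariablesRel) : domainEuler c = 0 := by
  obtain ⟨n, r, r', Φ, Φ', h1, -, h3, h4, -, rfl⟩ := hc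
  rw [map_sub, domainEuler_of, domainEuler_of, sub_eq_zero, realEuler, realEuler, h4]
  exact (hE isOMinimal_real definable_lt_real r.domain Φ (definable_univ_of_isSemialgebraic h1) h3).symm

/-- **Rules (2) + (3) preserve `E` of the domain** (modulo (2.4)). [cite: Dries1998, Ch. 4 (2.4)] -/
theorem closure_cov_nl_le_ker_domainEuler (hE : Dries1998_ch4_prop_2_4 Language.orderedRing ℝ) :
    AddSubgroup.closure (changeOfVariablesRel ∪ newtonLeibnizRel) ≤ domainEuler.ker := by
  refine (AddSubgroup.closure_le _).mpr ?_
  rintro c (hc | hc)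
  · exact domainEuler_eq_zero_of_mem_changeOfVariablesRel hE hc
  · exact domainEuler_eq_zero_of_mem_newtonLeibnizRel hc

/-- `domainEuler ([r₀] − [r₀']) = E((0,1)²) − E(ℝ) = 1 − (−1) = 2`. [folklore] -/
theorem domainEuler_legendre : domainEuler (of legendreRep - of arctanRep) = 2 := by
  rw [map_sub, domainEuler_of, domainEuler_of, realEuler_legendreRep_domain, realEuler_arctanRep_domain]
  norm_num

/-- **ADDITIVITY IS NECESSARY (modulo van den Dries (2.4))**: `[r₀] − [r₀']` is NOT in the
subgroup generated by the change-of-variables and Newton–Leibniz moves alone; every derivation of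
the crux uses an additivity move (1a)/(1b). With `legendre_not_mem_closure_without_newtonLeibniz`
(part 2): every derivation uses rule (1) AND rule (3). [cite: Dries1998, Ch. 4 (2.4)] -/
theorem legendre_not_mem_closure_without_additivity (hE : Dries1998_ch4_prop_2_4 Language.orderedRing ℝ) :
    of legendreRep - of arctanRep ∉ AddSubgroup.closure (changeOfVariablesRel ∪ newtonLeibnizRel) := by
  intro h
  have h0 := closure_cov_nl_le_ker_domainEuler hE h
  rw [AddMonoidHom.mem_ker, domainEuler_legendre] at h0
  norm_num at h0

/-- Unconditionally: Newton–Leibniz moves ALONE do not derive the crux (they preserve `E` of the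
domain). [folklore] -/
theorem legendre_not_mem_closure_newtonLeibniz :
    of legendreRep - of arctanRep ∉ AddSubgroup.closure newtonLeibnizRel := by
  intro h
  have hle : AddSubgroup.closure newtonLeibnizRel ≤ domainEuler.ker :=
    (AddSubgroup.closure_le _).mpr fun c hc => domainEuler_eq_zero_of_mem_newtonLeibnizRel hc
  have h0 := hle h
  rw [AddMonoidHom.mem_ker, domainEuler_legendre] at h0
  norm_num at h0

end Summit.KontsevichZagierPeriods.KontsevichZagierPeriods.Cruxes.GpcLegendreLemniscatic.Disproof
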